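import Literature.MathematicalPhysics.QuantumFieldTheory.Balaban1983to89.B7Prop1Explicit
import Literature.MathematicalPhysics.QuantumFieldTheory.Balaban1983to89.B7Prop2Explicit
import Literature.MathematicalPhysics.QuantumFieldTheory.Balaban1983to89.B8
import Literature.MathematicalPhysics.QuantumFieldTheory.Balaban1983to89.B8Lemma1Lattice

/-!
# `Balaban1983to89.B8Lemma1NonAbelian` — Lemma 1 of B8 (p. 79), NON-ABELIAN: the bound (1.25)
# `|V′ − 1| < 4d²α₀ + α₁` kernel-proved for `G`-valued bond fields (`G = U1 𝔸 ⊇ U(N)`) on the `ℤ^d` carriers of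
# `B7Prop1Explicit`, with the average (42) of [3]; the leaf `B8.Lemma1Printed d (blockPairNA d L 𝔸)` discharged

CITATION HEADER (lean-in-tree rule 2026-08-18).  Kernel certificate for Lemma 1 of T. Bałaban, *Spaces of regular
gauge field configurations on a lattice and gauge fixing conditions*, Comm. Math. Phys. **99**, 75–102 (1985)
[Balaban1985RegularSpaces] (cell paper B8 of the audit cell `pub-balaban`; `paper:balaban1985-cmp99-regular-spaces-
gauge-fixing`, journal page = PDF page + 74), pp. 77, 79–80 [PDF 3, 5–6], in the GENUINELY NON-COMMUTATIVE setting,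
with the block / contour / tree / averaging objects of [3] = T. Bałaban, *Averaging operations for lattice gauge
theories*, Comm. Math. Phys. **98**, 17–51 (1985) [Balaban1985Averaging] (cell paper B7) EXACTLY AS ALREADY TYPED IN
THE TREE in `B7Prop1Explicit` ((9) `hol`, (14) `gammaWord`, (42) `Wcx`/`Xavg`/`bavg`, B5 (1.7) trees `treeWord`/
`axialFn`, the corner blocks `boxVec`, the group `U1 𝔸`).  Renders re-read AS IMAGES by the filing unit on 2026-08-19:
`…1985-cmp99-regular-spaces-gauge-fixing-p005-x2.png` (p. 79), `-p006-x2.png` (p. 80); (1.7) p. 77 as quoted in the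
tree file `B8Lemma1Lattice` (same render set).  The paper is a manuscript UNDER ADJUDICATION by the cell; nothing of
it is asserted here: every hypothesis below is a typed DEFINITION and the printed conclusion is PROVED; no printed
claim, no programme-internal statement enters as a hypothesis.

PRINTED (B8 p. 79): "**Lemma 1.** Let V₀, V′V₀ satisfy the condition (1.7) for k = 1 and L arbitrary, and let
(R(V₀)V′)(Γ_{y,x}) = 1 for x ∈ B(y), |\overline{V′V₀} − V̄₀| < α₁ on Ω₁^{(1)}. (1.24)
Then for α₀, α₁ small the configuration V′ is also small, more precisely we have the bound
|V′ − 1| < 4d²α₀ + α₁ on Ω₁. (1.25)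
We will prove the lemma. From (1.22) and the assumptions we have |(∂_{V₀}V′)(p) − 1| ≦ |V₀(∂p) − 1| +
|(V′V₀)(∂p) − 1| < 2α₀L⁻². (1.26)  The conditions (R₀V′)(Γ_{y,x}) = 1, x ∈ B(y), imply V′_b = 1 for b ⊂ Γ_{y,x}.
This and the above estimate imply |V′_b − 1| < (d−1)(L−1)2α₀L⁻² for b ⊂ B(y) by the same reasoning as in [3]
(between (44) and (46)). For a plaquette p connecting two neighboring blocks B(c₋), B(c₊) we take two bonds b′, b″ ⊂
∂p, b′, b″ ∈ B(c) and … we get |R(V₀(b′₋, b″₋))V′_{b″} − V′_{b′}| < 2α₀L⁻² + 4(d−1)α₀L⁻¹ < 4dα₀L⁻¹. Thus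
|R(V₀(Γ_{b₀,₋,b₋}))V′_b − V′_{b₀}| < (d−1)(L−1)4dα₀L⁻¹ < 4(d−1)dα₀ for an arbitrary bond b ∈ B(c) and b₀ being the
unique bond of c belonging to B(c). The condition |\overline{V′V₀} − V̄₀| = |Ṽ′ − 1| < α₁ implies
|R(V₀([c₋, b₀,₋]))V′_{b₀} − 1| ≦ 4(d−1)" (p. 80) "(L−1)Lα₀L⁻² + α₁ < 4(d−1)α₀ + α₁, hence finally we have the bound
(1.25) for an arbitrary bond b.  From this proof it follows that the result is local in the sense that the bound
(1.25) for a bond b depends on bounds (1.7), (1.24) on B(c₋)∪B(c₊), if b belongs to this set.  The bound (1.25)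
holds for arbitrary L, unfortunately for L large it is too weak."
PRINTED (B8 p. 79): "(R̄ⁿ_{0,x_{n+1}}Ũ′ⁿ)(Γ_{x_{n+1},x_n}) = ∏_{b⊂Γ_{x_{n+1},x_n}} R(Ūⁿ₀(Γ_{x_{n+1},b₋}))Ũ′ⁿ_b = 1,
(1.19)";  "Ũ′ⁿ = (\overline{U′U₀})ⁿ(Ūⁿ₀)⁻¹. (1.20)";  "U(∂p) = (U′U₀)(∂p) = U′(x,y)R(U₀(x,y))U′(y,z)U₀(∂p)R(U₀(x,w))
U′(z,w)U′(w,x), (1.21)";  "Bʲ(c) = {b ⊂ T : b₋ ∈ Bʲ(c₋), b₊ ∈ Bʲ(c₊)}. (1.23)".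
PRINTED (B8 p. 77): "|U(∂p) − 1| < α₀L^{−2j} for p ∈ Ω_j, j = 0, 1, …, k, (1.7)".

READING / DICTIONARY (the cell's typing; not the paper's words).  `G`-valued bond fields ↦ `V : Site d → Fin d → 𝔸ˣ`
with values in the subgroup `U1 𝔸 = {u : ‖u‖ ≤ 1, ‖u⁻¹‖ ≤ 1}` of the units of a complete normed `ℂ`-algebra with
`‖1‖ = 1` (`B7Prop1Explicit.U1`; the printed `G ⊂ U(N) ⊂ M_N(ℂ)` with the operator norm, or the unitary group of any
C⋆-algebra, is `U1`-valued: `B7Prop2Explicit.unitaryUnits_le_U1`, whence `lemma1_unitary`); `|A − 1|` ↦ `‖A − 1‖`;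
`V(Γ)` ↦ `hol V x Γ` ((9) of [3]); `R(g)h = g h g⁻¹`; the trees `Γ_{y,x}` ↦ `treeWord (x − y)` / `axialFn V y x =
V(Γ_{y,x})` (B5 (1.7), directions `d, …, 1`); corner blocks `B(y) = y + [0, L)^d` ↦ `InBlock` / `y + boxVec L r`;
a positively oriented coarse bond `c = ⟨y, y + Le_κ⟩` has `B(c₋) = B(y)`, `B(c₊) = B(y + Le_κ)`, and `B(c₋) ∪ B(c₊)`
is the box `[y, y + pairTop L κ]` (`pairTop = (L−1, …, 2L−1 (slot κ), …, L−1)`); `U := V′V₀` bondwise ((1.21),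
`mulCfg`), `V′ = U V₀⁻¹` (`pert`); (1.7)`_{k=1}` ↦ `PlaqSmall V y (y + pairTop L κ) (α₀/L²)`: `‖V(∂p) − 1‖ ≤ α₀L⁻²` for
every plaquette with its four corners in `B(c₋) ∪ B(c₊)` (strict `<` in the carriers, `PlaqSmallLT`); the covariant
axial condition `(R(V₀)V′)(Γ_{y,x}) = 1` of (1.24), with (1.19)'s ordered product `covProd`, is EQUIVALENT along the
(forward) tree contours to `U(Γ_{y,x}) = V₀(Γ_{y,x})` (`hol_mulCfg_eq_covProd_mul`, `covProd_eq_one_iff`) and is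
typed in that form for both blocks (`Hyp.axial`, `Hyp.axial₁`); `|\overline{V′V₀} − V̄₀| < α₁` at `c` ↦
`‖bavg L U y κ − bavg L V₀ y κ‖ ≤ α₁` with the average (42) `bavg` of `B7Prop1Explicit` (exponent `Xavg` = `L^{−d} Σ_x
log[V(Γ_{c,x})V(c)⁻¹]`, `log` = the series (21) `MatrixLog.mlog`); `|V′ − 1|` on the bonds of `B(c₋) ∪ B(c₊)` ↦
`pertDev` = `sup` of `‖V′_b − 1‖` over the bonds with both ends there (`regionBonds`) — the index of the leaf family
is `Site d × Fin d` (all corners and directions, a superset of the bonds of `Ω₁^{(1)}`), exactly as for the abelian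
carriers `B8Lemma1Lattice.blockPair`, by the locality sentence of p. 80.

WHAT THE TREE ALREADY HAS.  `B8`: the abstract carrier `B8.LocalData` and the leaf `B8.Lemma1Printed d fam`
(= `DagBinding.B8LeafR.l1`), instanced so far ONLY in the abelian (additive) model (`B8Lemma1Lattice.
lemma1Printed_blockPair`; `B8Lemma1Abelian`), whose header records as NOT TYPED "the non-abelian remainders — the
R(·)-transports in (1.22)/(1.26) and in the crossing-bond chain, the BCH corrections behind (15) = (42), the
difference between |V − 1| and |(1/i) log V|".  `B7Prop1Explicit`: the `ℤ^d` words and transports, the tree gauge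
(`gaugeAct`, `axialFn`, `axial_bond_eq` = the bond identity of [3] p. 24 with `l1 (x − y)` plaquettes), `U1`, the
average (42) and `norm_avg_le`; `B7Prop2Explicit` (`unitaryUnits_le_U1`); `MatrixLog` (`norm_mlog_le_two_mul`);
`B7Transfer` (`norm_exp_sub_one_le_of_le`); `B8Ineq170` (`norm_mul_sub_one_le_of_norm_le_one`); `B8Lemma1Lattice`
(`InBlock`, `blockSites`, `mem_blockSites`: the corner blocks as predicates / `Finset`s, reused verbatim).

WHAT THIS FILE ADDS (kernel-checked, non-commutative throughout; new sibling module, nothing above is edited).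
§1 `lowPart μ v` (the coordinates `< μ` of `v`), tree words over direction lists (`tw`, `tw_walk`), forward letters.
§2 **The SHARP tree-gauge bond identity** `axial_bond_eq_sharp`: in the gauge `V^y = (axialFn V y)·V`, the bond
   variable `V^y_{⟨x,x+e_μ⟩}` is conjugate to the plaquette ladder over `Γ_{x̂,x}`, `x̂ = x − lowPart μ (x − y)` — only
   the `Σ_{κ<μ}|x_κ − y_κ|` LAST tree bonds enter ("V′_b = 1 for b ⊂ Γ_{y,x}": `axial_treeBond_eq_one`).
§3 Under the LOCAL hypothesis `PlaqSmall V lo hi a`: `‖V^y_{x,μ} − 1‖ ≤ (Σ_{κ<μ}|x_κ − y_κ|)·a`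
   (`axial_bond_bound_sharp`,
   = the printed "(|x₁ − y₁| + … + |x_{μ−1} − y_{μ−1}|)α₀" of [3] p. 24, non-abelian, by `U1`-conjugation invariance),
   segment and tree walks (`seg_walk`, `tw_walk`).
§4 The loops of (42) in the tree gauge: `W_{c,x} = V(Γ_{c,x})V(c)⁻¹ = Σ_x · T_x⁻¹` (`Wcx_axial_eq`: the segment
   `[x, x(c)]` and the tree `Γ_{c₊,x(c)}` read in the gauge at `y`), `‖W_{c,x} − 1‖ ≤ L·a·Σ_{κ'≠κ} r_{κ'} ≤ ω`,
   `ω := (d−1)(L−1)·L·a` (`norm_Wcx_sub_one_le_sharp`, `_omega`).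
§5 `‖X_c‖ ≤ 2ω` (`norm_Xavg_le`, via `|log W| ≤ 2|W − 1|`) and the comparison of the two straight transports through
   the two averages: `‖U(Γ_c)V₀(Γ_c)⁻¹ − 1‖ ≤ α₁e^{3s} + (e^{2s} − 1)` whenever `‖X_c[U]‖, ‖X_c[V₀]‖ ≤ s` and
   `‖Ū_c − V̄₀,c‖ ≤ α₁` (`norm_segRatio_sub_one_le`; `V(Γ_c) = e^{−X_c}V̄_c`).
§6 (1.19)–(1.21): `mulCfg`, `pert`, `covProd`, `hol_mulCfg_eq_covProd_mul`, `covProd_eq_one_iff`.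
§7 **Lemma 1 on `B(c₋) ∪ B(c₊)`**: interior bonds `‖V′_b − 1‖ ≤ 2(Σ_{κ<μ}|x_κ − z_κ|)α₀L⁻² ≤ (d−1)(L−1)·2α₀L⁻²`
   (`interior_bound` — the printed interior constant, now non-abelian); the crossing bonds `b ∈ B(c)` (1.23) via the
   purely algebraic `crossing_identity` `V′_b = V₀(Γ_{y,x})⁻¹·[U^y_b · T_U⁻¹ · U(Γ_c)V₀(Γ_c)⁻¹ · T_{V₀} · ((V₀)^y_b)⁻¹]·
   V₀(Γ_{y,x})` and `crossing_bound` `≤ 2ω + α₁e^{3s} + e^{2s} − 1`; the hypotheses record `Hyp`; **`lemma1_explicit`**: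
   `6ω ≤ 1 ⇒ ‖V′_b − 1‖ ≤ α₁ + ω(10 + 12α₁)` for EVERY bond of `B(c₋) ∪ B(c₊)`; **`lemma1_printedBound`**: for
   `a = α₀L⁻²`, `0 < α₀ ≤ 1/(6(d+1))`, `0 ≤ α₁ ≤ 1/6`: `‖V′_b − 1‖ < 4d²α₀ + α₁` (indeed `≤ α₁ + 12(d−1)((L−1)/L)α₀`).
§8 The carriers **`blockPairNA d L 𝔸 : Site d × Fin d → B8.LocalData`** (`Small` = `U1`-valued + (1.7)`_{k=1}` strict
   for `V₀` and `V′V₀`; `AxialClose` = (1.24) strict; `pertDev`) and **`lemma1Printed_blockPairNA (d L : ℕ) (𝔸) :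
   B8.Lemma1Printed d (blockPairNA d L 𝔸)`** — hypothesis-free, `c = 1/(6(d+1))` (`L = 0`: empty region; `d = 0`: no
   index); `lemma1_unitary` (unitary-valued fields in a C⋆-algebra).  Axioms: `propext`, `Classical.choice`,
   `Quot.sound`.

PROOF ROUTE — HONEST COMPARISON WITH THE PRINTED PROOF.  The printed proof chains covariant differences from the bond
`b₀` of `c` through `≤ (d−1)(L−1)` neighbouring crossing bonds (`4dα₀L⁻¹` a step) and closes at `b₀` with the average
condition; the cell's census G-B8-10 (`B8Lemma1Abelian.printedChain_gt`) records that this chain, completed literally,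
exceeds the printed `4d²` for `d ≥ 2`, and the abelian certificate uses a mean-based reading of the last step.  THIS
FILE DOES NOT FOLLOW THAT CHAIN: it organises the estimate gauge-invariantly through the loops `W_{c,x}` of the average
itself (§4–§5) and ONE algebraic factorisation per crossing bond (§7), which lands strictly inside the printed constant
(`12(d−1) ≤ 4d² − 4`) with no BCH formula and no expansion in `V′ − 1` — the non-commutativity is absorbed exactly by
conjugation invariance under `U1` and by the elementary `‖e^{X}‖ ≤ e^{‖X‖}`, `e^t ≤ 1 + 2t (0 ≤ t ≤ 1)`.  What is
certified is therefore the printed STATEMENT (1.24) ⇒ (1.25) with the printed constant and the printed locality, and the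
printed interior-bond constant; the printed intermediate constants `4dα₀L⁻¹`, `4(d−1)dα₀`, `4(d−1)α₀ + α₁` of the
chain are NOT reproduced (different route), and (1.26) is used only through its two ingredients (the two (1.7)-bounds).

HONEST SCOPE / NOT TYPED.  (i) Model: `U1 𝔸`-valued fields, `𝔸` any complete normed `ℂ`-algebra with `‖1‖ = 1` (for
`M_N(ℂ)` with the operator norm and `G ⊂ U(N)` this is the printed setting; the series `log` of (42) needs
`‖W − 1‖ < 1`, guaranteed here by `ω ≤ 1/6`).  (ii) "for α₀, α₁ small" is made explicit as `α₀, α₁ ≤ 1/(6(d+1))` in the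
leaf (`lemma1_printedBound` itself needs `α₀ ≤ 1/(6(d+1))`, `α₁ ≤ 1/6`); no optimality is claimed.  (iii) Only the
`j = 1` clause of (1.7) is used and only for plaquettes inside `B(c₋) ∪ B(c₊)`; (1.24) only on `B(c₋) ∪ B(c₊)` and at
the one coarse bond `c` — this is the locality sentence of p. 80, here a theorem (`lemma1_explicit` quantifies nothing
outside the box `[y, y + pairTop L κ]`).  (iv) Corner-anchored blocks, `d`-first trees, positively oriented `c`: the
conventions of `B7Prop1Explicit` / `B8Lemma1Lattice`; other corners/orderings are coordinate relabellings, a negatively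
oriented `c` is the same configuration read from the other block.  (v) The core theorems take `≤`-hypotheses (formally
stronger conclusions); the carriers use the printed strict `<`.  (vi) Nothing here bears on Theorem 2 / (1.65) beyond
supplying the leaf `l1` for one concrete NON-ABELIAN family; `DagBinding.B8LeafR` is not instantiated (its other fields
are Thm 2 – Thm 8 carriers).  Value = kernel certificate of a printed lemma, in its own non-commutative setting, on
concrete carriers + one DAG leaf discharged by name; NOT summit progress.  Second engine (pure python, random `SU(2)`
fields, `d ∈ {2,3}`, `L ∈ {2,3,4}`): `code/b2b-balaban-b08/g17/`.  Unit `b2b-balaban-b08` gen 17 (journal claim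
LEMMA1-NONABELIAN-KERNEL; census C-B8-41, DIVERGENCE D-b08-g17.1).
-/

noncomputable section

open scoped BigOperators
open NormedSpace Finset

namespace Literature.MathematicalPhysics.QuantumFieldTheory.Balaban1983to89.B8Lemma1NonAbelian

open B7Prop1Explicit MatrixLog
-- the corner blocks `B(z)` (`InBlock L z x : ∀ κ, z κ ≤ x κ ∧ x κ < z κ + L`) and their `Finset`s are REUSED from the
-- abelian sibling `B8Lemma1Lattice` (same `ℤ^d` sites `Fin d → ℤ`); nothing else of that file is used.
open B8Lemma1Lattice (InBlock blockSites mem_blockSites)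

-- `Site` alone would resolve to the torus sites `Balaban1983to89.Site (P : Params) j` of `Setup.lean` (parent
-- namespace beats `open`); re-export the `ℤ^d` sites of `B7Prop1Explicit` into this namespace (as B7Prop2Explicit).
export B7Prop1Explicit (Site)

variable {d : ℕ}

/-! ## §1 Lattice combinatorics: the part of a vector below a coordinate; tree words over a list of directions -/

/-- The part of `v ∈ ℤ^d` in the coordinates `< μ` (the coordinates changed LAST by the tree contour `Γ_{y,y+v}`
of B5 (1.7), which runs through the directions in the order `d, d−1, …, 1`). [folklore] -/
def lowPart (μ : Fin d) (v : Site d) : Site d := fun κ => if κ < μ then v κ else 0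

/-- `lowPart_apply` — bookkeeping. [folklore] -/
@[simp] theorem lowPart_apply (μ : Fin d) (v : Site d) (κ : Fin d) :
    lowPart μ v κ = if κ < μ then v κ else 0 := rfl

/-- `lowPart_add` — bookkeeping. [folklore] -/
theorem lowPart_add (μ : Fin d) (u v : Site d) : lowPart μ (u + v) = lowPart μ u + lowPart μ v := by
  funext κ; simp only [lowPart_apply, Pi.add_apply]; split_ifs <;> simp

/-- `lowPart_sub` — bookkeeping. [folklore] -/
theorem lowPart_sub (μ : Fin d) (u v : Site d) : lowPart μ (u - v) = lowPart μ u - lowPart μ v := by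
  funext κ; simp only [lowPart_apply, Pi.sub_apply]; split_ifs <;> simp

/-- `lowPart_zero` — bookkeeping. [folklore] -/
@[simp] theorem lowPart_zero (μ : Fin d) : lowPart μ (0 : Site d) = 0 := by
  funext κ; simp

/-- `zsmul_e_apply` — bookkeeping. [folklore] -/
theorem zsmul_e_apply (n : ℤ) (κ κ' : Fin d) : (n • e κ : Site d) κ' = if κ' = κ then n else 0 := by
  simp [e_apply]

/-- `zsmul_e_apply_self` — bookkeeping. [folklore] -/
theorem zsmul_e_apply_self (n : ℤ) (κ : Fin d) : (n • e κ : Site d) κ = n := by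
  rw [zsmul_e_apply, if_pos rfl]

/-- `e_apply_self` — bookkeeping. [folklore] -/
theorem e_apply_self (κ : Fin d) : e κ κ = 1 := by simp [e_apply]

/-- `e_apply_of_ne` — bookkeeping. [folklore] -/
theorem e_apply_of_ne {κ ν : Fin d} (h : κ ≠ ν) : e ν κ = 0 := by simp [e_apply, h]

/-- `lowPart_zsmul_e_of_le`: a multiple of `e_κ` has no part below `μ ≤ κ`. [folklore] -/
theorem lowPart_zsmul_e_of_le {μ κ : Fin d} (h : μ ≤ κ) (n : ℤ) : lowPart μ (n • e κ) = 0 := by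
  funext κ'
  simp only [lowPart_apply, zsmul_e_apply, Pi.zero_apply]
  split_ifs with h1 h2
  · exact absurd (h2 ▸ h1) (not_lt.mpr h)
  · rfl
  · rfl

/-- `lowPart_zsmul_e_of_lt`: a multiple of `e_κ`, `κ < μ`, is its own part below `μ`. [folklore] -/
theorem lowPart_zsmul_e_of_lt {μ κ : Fin d} (h : κ < μ) (n : ℤ) : lowPart μ (n • e κ) = n • e κ := by
  funext κ'
  simp only [lowPart_apply, zsmul_e_apply]
  split_ifs with h1 h2 h3
  · rfl
  · rfl
  · exact absurd (h3 ▸ h) h1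
  · rfl

/-- `lowPart_nonneg` — bookkeeping. [folklore] -/
theorem lowPart_nonneg (μ : Fin d) {v : Site d} (hv : 0 ≤ v) : 0 ≤ lowPart μ v := by
  intro κ; simp only [lowPart_apply, Pi.zero_apply]; split_ifs
  · exact hv κ
  · exact le_rfl

/-- `lowPart_le_self` — bookkeeping. [folklore] -/
theorem lowPart_le_self (μ : Fin d) {v : Site d} (hv : 0 ≤ v) : lowPart μ v ≤ v := by
  intro κ; simp only [lowPart_apply]; split_ifs
  · exact le_rfl
  · exact hv κ

/-- `l1_lowPart_eq` — bookkeeping: `|lowPart μ v|₁ = Σ_{κ<μ} |v_κ|`. [folklore] -/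
theorem l1_lowPart_eq (μ : Fin d) (v : Site d) :
    l1 (lowPart μ v) = ∑ κ, if κ < μ then (v κ).natAbs else 0 := by
  unfold l1
  refine Finset.sum_congr rfl fun κ _ => ?_
  simp only [lowPart_apply]; split_ifs <;> simp

/-- `e_nonneg` — bookkeeping: `0 ≤ e_κ` in the product order of `ℤ^d`. [folklore] -/
theorem e_nonneg (κ : Fin d) : (0 : Site d) ≤ e κ := by
  intro κ'; simp only [Pi.zero_apply, e_apply]; split_ifs <;> norm_num

/-- `zsmul_e_nonneg` — bookkeeping. [folklore] -/
theorem zsmul_e_nonneg {n : ℤ} (hn : 0 ≤ n) (κ : Fin d) : (0 : Site d) ≤ n • e κ := by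
  intro κ'; simp only [Pi.zero_apply, zsmul_e_apply]; split_ifs <;> omega

/-- The tree word restricted to a list of directions: `tw ks v` walks the coordinates of `v` listed in `ks`, in
that order; `treeWord v = tw [d−1, …, 0] v`. [folklore] -/
def tw (ks : List (Fin d)) (v : Site d) : List (Letter d) := ks.flatMap fun κ => seg κ (v κ)

/-- `treeWord_eq_tw` — bookkeeping. [folklore] -/
theorem treeWord_eq_tw (v : Site d) : treeWord v = tw (List.finRange d).reverse v := rfl

/-- `tw_nil` — bookkeeping. [folklore] -/
@[simp] theorem tw_nil (v : Site d) : tw [] v = [] := rfl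

/-- `tw_cons` — bookkeeping. [folklore] -/
@[simp] theorem tw_cons (κ : Fin d) (ks : List (Fin d)) (v : Site d) :
    tw (κ :: ks) v = seg κ (v κ) ++ tw ks v := by
  simp [tw]

/-- `tw_congr` — bookkeeping. [folklore] -/
theorem tw_congr {ks : List (Fin d)} {u v : Site d} (h : ∀ κ ∈ ks, u κ = v κ) : tw ks u = tw ks v :=
  flatMap_congr_of fun κ hκ => by rw [h κ hκ]

/-- The list `[d−1, …, 0]` of directions is strictly decreasing. [folklore] -/
theorem pairwise_gt_finRange_reverse (d : ℕ) : ((List.finRange d).reverse).Pairwise (fun a b => b < a) :=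
  List.pairwise_reverse.mpr (List.pairwise_lt_finRange d)

/-- Letters of a tree word of a non-negative vector are forward steps. [folklore] -/
theorem forward_of_mem_treeWord {v : Site d} (hv : 0 ≤ v) {l : Letter d} (hl : l ∈ treeWord v) :
    l = (l.1, true) := by
  rw [treeWord, List.mem_flatMap] at hl
  obtain ⟨κ, -, hκ⟩ := hl
  obtain ⟨n, hn⟩ := Int.eq_ofNat_of_zero_le (hv κ)
  rw [hn, seg_natCast, List.mem_replicate] at hκ
  rw [hκ.2]

/-- Directions occurring in a tree word are coordinates where the vector is non-zero. [folklore] -/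
theorem ne_zero_of_mem_treeWord {v : Site d} {l : Letter d} (hl : l ∈ treeWord v) : v l.1 ≠ 0 := by
  rw [treeWord, List.mem_flatMap] at hl
  obtain ⟨κ, -, hκ⟩ := hl
  have h1 := mem_seg hκ
  intro h0
  rw [← h1, h0, seg_zero] at hκ
  simp at hκ

/-- A word of forward letters has non-negative displacement. [folklore] -/
theorem disp_nonneg_of_forward : ∀ {w : List (Letter d)}, (∀ l ∈ w, l = (l.1, true)) → (0 : Site d) ≤ disp w
  | [], _ => by simp
  | l :: w, h => by
    rw [disp_cons, h l (by simp)]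
    simp only [Letter.vec_true]
    exact add_nonneg (e_nonneg _) (disp_nonneg_of_forward fun l' hl' => h l' (List.mem_cons_of_mem l hl'))

/-! ## §2 The tree (axial) gauge: the SHARP form of the bond identity of [Balaban1985Averaging] p. 24

`B7Prop1Explicit.axial_bond_eq` exhibits, for the axial gauge `V₀ = V^{v₀}` based at `y`, every bond variable
`V₀(x, x + e_μ)` as a conjugated ladder holonomy over a sub-word `Q` of `Γ_{y,x}` with `|Q| ≤ |x − y|₁`.  Here the
sub-word is identified: `Q = Γ`-tree word of the part of `x − y` BELOW `μ`, so `|Q| = Σ_{κ<μ} |x_κ − y_κ|`; in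
particular bonds ON the tree (`(x − y)_κ = 0` for `κ < μ`) have `V₀ = 1` exactly (p. 24: "`V₀(x, x + e₁) = 1`,
`|V₀(x, x + e₂) − 1| < |x₁ − y₁|α₀, …`" — in print's ordering of coordinates). -/

section Transport

variable {G : Type*} [Group G]

/-- **The sharp tree-gauge identity**: with `v = x − y`, `Lo = lowPart μ v`, `w = x − Lo` and `V₀ = V^{v₀}` the
axial gauge at `y`, `V₀(x, x+e_μ) = V₀(Q)⁻¹ · V₀(ladder Q μ) · V₀(Q)` for `Q = treeWord Lo` spelled from `w`.
[cite: Balaban1985Averaging, pp.24–25] -/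
theorem axial_bond_eq_sharp (V : Site d → Fin d → G) (y x : Site d) (μ : Fin d) :
    gaugeAct (axialFn V y) V x μ =
      (hol (gaugeAct (axialFn V y) V) (x - lowPart μ (x - y)) (treeWord (lowPart μ (x - y))))⁻¹ *
        hol (gaugeAct (axialFn V y) V) (x - lowPart μ (x - y)) (ladder (treeWord (lowPart μ (x - y))) μ) *
        hol (gaugeAct (axialFn V y) V) (x - lowPart μ (x - y)) (treeWord (lowPart μ (x - y))) := by
  obtain ⟨s, t, hst⟩ := List.append_of_mem (a := μ) (l := (List.finRange d).reverse) (by simp)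
  have hpw := pairwise_gt_finRange_reverse d
  rw [hst] at hpw
  have hs : ∀ κ ∈ s, μ < κ := fun κ hκ => (List.pairwise_append.mp hpw).2.2 κ hκ μ (by simp)
  have ht : ∀ κ ∈ t, κ < μ := fun κ hκ => List.rel_of_pairwise_cons (List.pairwise_append.mp hpw).2.1 hκ
  have hnd : (s ++ μ :: t).Nodup := by
    rw [← hst]; exact List.nodup_reverse.mpr (List.nodup_finRange d)
  have hμst : μ ∉ s ++ t := (List.nodup_cons.mp (List.nodup_middle.mp hnd)).1
  rw [List.mem_append, not_or] at hμst
  -- notation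
  set V₀ := gaugeAct (axialFn V y) V with hV₀
  set v : Site d := x - y with hv
  let f : Fin d → List (Letter d) := fun κ => seg κ (v κ)
  have hne : ∀ κ, κ ≠ μ → seg κ ((v + e μ) κ) = f κ := by
    intro κ hκ; simp [f, e, hκ]
  have hμμ : seg μ ((v + e μ) μ) = seg μ (v μ + 1) := by simp [e]
  have h1 : treeWord v = s.flatMap f ++ (seg μ (v μ) ++ t.flatMap f) := by
    rw [treeWord, hst, List.flatMap_append, List.flatMap_cons]
  have h2 : treeWord (v + e μ) = s.flatMap f ++ (seg μ (v μ + 1) ++ t.flatMap f) := by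
    rw [treeWord, hst, List.flatMap_append, List.flatMap_cons, hμμ,
      flatMap_congr_of (s := s) (fun κ hκ => hne κ (fun h => hμst.1 (h ▸ hκ))),
      flatMap_congr_of (s := t) (fun κ hκ => hne κ (fun h => hμst.2 (h ▸ hκ)))]
  -- the tree word of the low part is the tail block `t.flatMap f`
  have hQ : treeWord (lowPart μ v) = t.flatMap f := by
    rw [treeWord, hst, List.flatMap_append, List.flatMap_cons]
    have e1 : s.flatMap (fun κ => seg κ (lowPart μ v κ)) = [] :=
      List.flatMap_eq_nil_iff.mpr fun κ hκ => by
        rw [lowPart_apply, if_neg (not_lt.mpr (hs κ hκ).le), seg_zero]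
    have e2 : seg μ (lowPart μ v μ) = [] := by simp
    have e3 : t.flatMap (fun κ => seg κ (lowPart μ v κ)) = t.flatMap f :=
      flatMap_congr_of (s := t) fun κ hκ => by simp only [f, lowPart_apply, if_pos (ht κ hκ)]
    rw [e1, e2, e3, List.nil_append, List.nil_append]
  have ht1 := hol_axial_treeWord V y v
  have ht2 := hol_axial_treeWord V y (v + e μ)
  rw [← hV₀] at ht1 ht2
  rw [h1, hol_append, hol_append] at ht1
  rw [h2, hol_append, hol_append, hol_seg_succ, disp_seg, add_smul, one_smul, ← add_assoc] at ht2
  set z := y + disp (s.flatMap f) with hz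
  set w := z + v μ • e μ with hw
  set Q := t.flatMap f with hQdef
  rw [disp_seg] at ht1
  have hdQ : disp Q = lowPart μ v := by rw [← hQ, disp_treeWord]
  have hx : w + disp Q = x := by
    have := disp_treeWord v
    rw [h1, disp_append, disp_append, disp_seg] at this
    rw [hw, hz, add_assoc, add_assoc, this, hv, add_sub_cancel]
  have hw' : x - lowPart μ (x - y) = w := by rw [← hv, ← hdQ, ← hx, add_sub_cancel_right]
  rw [hw', hQ]
  have h3 : hol V₀ w Q = V₀ w μ * hol V₀ (w + e μ) Q := by
    have := ht1.trans ht2.symm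
    rw [mul_assoc] at this
    exact mul_left_cancel (mul_left_cancel this)
  rw [hol_ladder, hx, h3]
  group

/-- **Tree bonds are trivial in the tree gauge**: if `x − y` vanishes below `μ` then `V₀(x, x + e_μ) = 1`
(no smallness needed). [cite: Balaban1985Averaging, p.24] -/
theorem axial_treeBond_eq_one (V : Site d → Fin d → G) (y x : Site d) (μ : Fin d)
    (h : lowPart μ (x - y) = 0) : gaugeAct (axialFn V y) V x μ = 1 := by
  rw [axial_bond_eq_sharp, h, treeWord_zero, sub_zero, hol_nil, hol_ladder]
  simp

end Transport

/-! ## §3 Estimates in the tree gauge under a LOCAL plaquette hypothesis -/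

section Local

variable {𝔸 : Type*} [NormedRing 𝔸] [NormOneClass 𝔸]

/-- **(1.7) for `k = 1`, localised to an order interval** `[lo, hi] ⊂ ℤ^d`: every unit plaquette with all four
corners in `[lo, hi]` satisfies `|V(∂p) − 1| ≤ a`. [cite: Balaban1985RegularSpaces, (1.7) p.77] -/
def PlaqSmall (V : Site d → Fin d → 𝔸ˣ) (lo hi : Site d) (a : ℝ) : Prop :=
  ∀ (x : Site d) (κ μ : Fin d), κ ≠ μ → lo ≤ x → x + e κ + e μ ≤ hi →
    ‖((hol V x (plaqWord κ μ) : 𝔸ˣ) : 𝔸) - 1‖ ≤ a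

omit [NormOneClass 𝔸] in
/-- `PlaqSmall.mono`: shrinking the interval keeps the hypothesis. [folklore] -/
theorem PlaqSmall.mono {V : Site d → Fin d → 𝔸ˣ} {lo hi lo' hi' : Site d} {a : ℝ} (h : PlaqSmall V lo hi a)
    (hlo : lo ≤ lo') (hhi : hi' ≤ hi) : PlaqSmall V lo' hi' a :=
  fun x κ μ hκμ hx hx' => h x κ μ hκμ (hlo.trans hx) (hx'.trans hhi)

omit [NormOneClass 𝔸] in
/-- `PlaqSmall.of_le` — bookkeeping: weakening the bound. [folklore] -/
theorem PlaqSmall.of_le {V : Site d → Fin d → 𝔸ˣ} {lo hi : Site d} {a b : ℝ} (h : PlaqSmall V lo hi a)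
    (hab : a ≤ b) : PlaqSmall V lo hi b :=
  fun x κ μ hκμ hx hx' => (h x κ μ hκμ hx hx').trans hab

/-- **Non-abelian Stokes, ladder form, LOCAL hypothesis**: as `B7Prop1Explicit.ladder_bound`, but assuming the
plaquette bound only for the elementary loops actually met along the word. [folklore] -/
theorem ladder_bound_local (V : Site d → Fin d → 𝔸ˣ) (hV : ∀ x κ, V x κ ∈ U1 𝔸) (μ : Fin d) {α : ℝ} :
    ∀ (w : List (Letter d)) (x : Site d), (∀ l ∈ w, l.1 ≠ μ) →
      (∀ (w₁ w₂ : List (Letter d)) (l : Letter d), w = w₁ ++ l :: w₂ →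
        ‖((hol V (x + disp w₁) (lplaqWord l μ) : 𝔸ˣ) : 𝔸) - 1‖ ≤ α) →
      ‖((hol V x (ladder w μ) : 𝔸ˣ) : 𝔸) - 1‖ ≤ w.length * α
  | [], _x, _, _ => by simp [ladder, stepHol_true, stepHol_false]
  | l :: w, x, hw, hP => by
    rw [hol_ladder_cons, Units.val_mul, List.length_cons, Nat.cast_succ, add_mul, one_mul]
    have ih := ladder_bound_local V hV μ w (x + l.vec) (fun l' hl' => hw l' (List.mem_cons_of_mem l hl'))
      (fun w₁ w₂ l' h => by
        have := hP (l :: w₁) w₂ l' (by rw [h]; rfl)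
        rwa [disp_cons, ← add_assoc] at this)
    have hl := hP [] w l rfl
    rw [disp_nil, add_zero] at hl
    have hg := stepHol_mem hV x l
    have hconj : ‖((stepHol V x l * hol V (x + l.vec) (ladder w μ) * (stepHol V x l)⁻¹ : 𝔸ˣ) : 𝔸) - 1‖
        ≤ ‖((hol V (x + l.vec) (ladder w μ) : 𝔸ˣ) : 𝔸) - 1‖ := by
      rw [Units.val_mul, Units.val_mul]
      exact norm_units_conj_sub_one_le hg _
    have hn1 : ‖((stepHol V x l * hol V (x + l.vec) (ladder w μ) * (stepHol V x l)⁻¹ : 𝔸ˣ) : 𝔸)‖ ≤ 1 :=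
      (mem_U1.mp ((U1 𝔸).mul_mem ((U1 𝔸).mul_mem hg (hol_mem hV _ _)) ((U1 𝔸).inv_mem hg))).1
    calc _ ≤ _ + _ := B8Ineq170.norm_mul_sub_one_le_of_norm_le_one hn1
      _ ≤ w.length * α + α := add_le_add (hconj.trans ih) hl

/-- **The sharp bond bound in the tree gauge, local form** ([Balaban1985Averaging] p. 24 l. −2 – p. 25 l. 3,
"`V₀(x, x + e₁) = 1`, `|V₀(x, x + e₂) − 1| < |x₁ − y₁|α₀, …`", used in [Balaban1985RegularSpaces] p. 79 "by the
same reasoning as in [3] (between (44) and (46))"): for `y ≤ x`, `|V₀(x, x + e_μ) − 1| ≤ (Σ_{κ<μ}|x_κ − y_κ|)·a`,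
assuming `|V(∂p) − 1| ≤ a` only for the plaquettes inside `[lo, hi] ⊇ [y, x + e_μ]`.
[cite: Balaban1985Averaging, pp.24–25] -/
theorem axial_bond_bound_sharp (V : Site d → Fin d → 𝔸ˣ) (hV : ∀ x κ, V x κ ∈ U1 𝔸) {lo hi : Site d} {a : ℝ}
    (hP : PlaqSmall V lo hi a) (y x : Site d) (μ : Fin d) (hlo : lo ≤ y) (hyx : y ≤ x) (hhi : x + e μ ≤ hi) :
    ‖((gaugeAct (axialFn V y) V x μ : 𝔸ˣ) : 𝔸) - 1‖ ≤ l1 (lowPart μ (x - y)) * a := by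
  set V₀ := gaugeAct (axialFn V y) V with hV₀
  have hV₀m : ∀ x κ, V₀ x κ ∈ U1 𝔸 := gaugeAct_mem hV (axialFn_mem hV y)
  set Lo : Site d := lowPart μ (x - y) with hLo
  set w : Site d := x - Lo with hw
  set Q : List (Letter d) := treeWord Lo with hQ
  have hLo0 : 0 ≤ Lo := lowPart_nonneg μ (sub_nonneg.mpr hyx)
  have hLole : Lo ≤ x - y := lowPart_le_self μ (sub_nonneg.mpr hyx)
  have hyw : y ≤ w := by
    rw [hw]; intro κ; have := hLole κ; simp only [Pi.sub_apply] at this ⊢; linarith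
  have hfw : ∀ l ∈ Q, l = (l.1, true) := fun l hl => forward_of_mem_treeWord hLo0 hl
  have hid := axial_bond_eq_sharp V y x μ
  rw [← hV₀, ← hLo, ← hw, ← hQ] at hid
  have hQμ : ∀ l ∈ Q, l.1 ≠ μ := by
    intro l hl hlμ
    have h0 := ne_zero_of_mem_treeWord hl
    rw [hlμ, hLo, lowPart_apply, if_neg (lt_irrefl μ)] at h0
    exact h0 rfl
  have hP' : ∀ (w₁ w₂ : List (Letter d)) (l : Letter d), Q = w₁ ++ l :: w₂ →
      ‖((hol V₀ (w + disp w₁) (lplaqWord l μ) : 𝔸ˣ) : 𝔸) - 1‖ ≤ a := by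
    intro w₁ w₂ l hsplit
    have hl : l ∈ Q := by rw [hsplit]; simp
    have hlf := hfw l hl
    have hκμ : l.1 ≠ μ := hQμ l hl
    -- positions: `0 ≤ disp w₁`, `disp w₁ + e_{l.1} ≤ Lo`
    have h01 : (0 : Site d) ≤ disp w₁ :=
      disp_nonneg_of_forward fun l' hl' => hfw l' (by rw [hsplit]; simp [hl'])
    have h02 : (0 : Site d) ≤ disp w₂ :=
      disp_nonneg_of_forward fun l' hl' => hfw l' (by rw [hsplit]; simp [hl'])
    have hsum : disp w₁ + e l.1 + disp w₂ = Lo := by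
      have := disp_treeWord Lo
      rw [← hQ, hsplit, disp_append, disp_cons, hlf] at this
      simpa [add_assoc] using this
    rw [hlf, lplaqWord_true, hV₀, hol_gaugeAct_closed _ _ _ _ (disp_plaqWord _ _), Units.val_mul, Units.val_mul]
    refine (norm_units_conj_sub_one_le (axialFn_mem hV y _) _).trans (hP _ _ _ hκμ ?_ ?_)
    · exact hlo.trans (hyw.trans (le_add_of_nonneg_right h01))
    · calc w + disp w₁ + e l.1 + e μ = w + (disp w₁ + e l.1) + e μ := by abel
        _ ≤ w + Lo + e μ := by
          have : disp w₁ + e l.1 ≤ Lo := by rw [← hsum]; exact le_add_of_nonneg_right h02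
          exact add_le_add (add_le_add le_rfl this) le_rfl
        _ = x + e μ := by rw [hw, sub_add_cancel]
        _ ≤ hi := hhi
  have hlad := ladder_bound_local V₀ hV₀m μ Q w hQμ hP'
  rw [hid, Units.val_mul, Units.val_mul]
  refine (norm_units_inv_conj_sub_one_le (hol_mem hV₀m _ _) _).trans (hlad.trans (le_of_eq ?_))
  rw [hQ, length_treeWord]

omit [NormOneClass 𝔸] in
/-- `axial_treeBond_norm`: the tree-bond case as a norm statement. [folklore] -/
theorem axial_treeBond_norm (V : Site d → Fin d → 𝔸ˣ) (y x : Site d) (μ : Fin d) (h : lowPart μ (x - y) = 0) :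
    ‖((gaugeAct (axialFn V y) V x μ : 𝔸ˣ) : 𝔸) - 1‖ = 0 := by
  rw [axial_treeBond_eq_one V y x μ h]; simp

/-! ### Walks: a straight segment, and a tree word from a shifted base point -/

/-- **Segment walk**: `|W([p, p + n e_κ]) − 1| ≤ Σ_j |W(p + je_κ, ·+e_κ) − 1| ≤ nβ`. [folklore] -/
theorem seg_walk (W : Site d → Fin d → 𝔸ˣ) (hW : ∀ x κ, W x κ ∈ U1 𝔸) (p : Site d) (κ : Fin d) {β : ℝ} :
    ∀ n : ℕ, (∀ j : ℕ, j < n → ‖((W (p + (j : ℤ) • e κ) κ : 𝔸ˣ) : 𝔸) - 1‖ ≤ β) →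
      ‖((hol W p (seg κ n) : 𝔸ˣ) : 𝔸) - 1‖ ≤ n * β
  | 0, _ => by simp
  | n + 1, h => by
    rw [show ((n + 1 : ℕ) : ℤ) = (n : ℤ) + 1 by push_cast; ring, hol_seg_natCast_succ, Units.val_mul,
      Nat.cast_succ, add_mul, one_mul]
    have ih := seg_walk W hW p κ n (fun j hj => h j (by omega))
    have hn := h n (by omega)
    have h1 : ‖((hol W p (seg κ n) : 𝔸ˣ) : 𝔸)‖ ≤ 1 := (mem_U1.mp (hol_mem hW _ _)).1
    calc _ ≤ _ + _ := B8Ineq170.norm_mul_sub_one_le_of_norm_le_one h1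
      _ ≤ n * β + β := add_le_add ih hn

/-- **Tree walk** over a strictly decreasing list of directions `ks` and a vector `v ≥ 0` from `p`: the bond of
direction `κ` met at `z` satisfies `p ≤ z`, `z + e_κ ≤ p + v` and `(z − p)_{κ'} = 0` for `κ' < κ` (the lower
coordinates have not been walked yet); summing per-direction bond bounds `β_κ` gives `Σ_κ |v_κ| β_κ`. [folklore] -/
theorem tw_walk (W : Site d → Fin d → 𝔸ˣ) (hW : ∀ x κ, W x κ ∈ U1 𝔸) (β : Fin d → ℝ) :
    ∀ (ks : List (Fin d)), ks.Pairwise (fun a b => b < a) → ∀ (v : Site d), 0 ≤ v → ∀ (p : Site d),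
      (∀ κ ∈ ks, ∀ z : Site d, p ≤ z → z + e κ ≤ p + v → lowPart κ (z - p) = 0 →
          ‖((W z κ : 𝔸ˣ) : 𝔸) - 1‖ ≤ β κ) →
      ‖((hol W p (tw ks v) : 𝔸ˣ) : 𝔸) - 1‖ ≤ (ks.map fun κ => ((v κ).natAbs : ℝ) * β κ).sum
  | [], _, v, _, p, _ => by simp
  | κ :: ks, hks, v, hv, p, h => by
    obtain ⟨n, hn⟩ := Int.eq_ofNat_of_zero_le (hv κ)
    have hκks : ∀ κ' ∈ ks, κ' < κ := fun κ' h' => List.rel_of_pairwise_cons hks h'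
    set v₁ : Site d := v - v κ • e κ with hv₁
    have hv₁κ : ∀ κ' ∈ ks, v₁ κ' = v κ' := by
      intro κ' h'
      have hne : κ' ≠ κ := (hκks κ' h').ne
      simp [hv₁, e_apply, hne]
    have hv₁0 : 0 ≤ v₁ := by
      intro κ'
      simp only [hv₁, Pi.sub_apply, zsmul_e_apply, Pi.zero_apply]
      split_ifs with hh
      · subst hh; simp
      · simpa using hv κ'
    have hpv : p + (n : ℤ) • e κ + v₁ = p + v := by rw [hv₁, hn]; abel
    have htw : tw ks v = tw ks v₁ := tw_congr fun κ' h' => (hv₁κ κ' h').symm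
    rw [tw_cons, hol_append, Units.val_mul, disp_seg, hn, List.map_cons, List.sum_cons, htw]
    -- the segment in direction κ
    have hseg := seg_walk W hW p κ n (fun j hj => h κ (by simp) (p + (j : ℤ) • e κ)
      (le_add_of_nonneg_right (zsmul_e_nonneg (by positivity) κ)) ?_ ?_)
    rotate_left
    · have e1 : p + (j : ℤ) • e κ + e κ = p + ((j : ℤ) + 1) • e κ := by rw [add_smul, one_smul, add_assoc]
      rw [e1]
      refine add_le_add le_rfl (fun κ' => ?_)
      simp only [zsmul_e_apply]
      split_ifs with hh
      · subst hh; rw [hn]; omega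
      · exact hv κ'
    · rw [add_sub_cancel_left]; exact lowPart_zsmul_e_of_le le_rfl _
    -- the rest of the tree, from `p + n e_κ`
    have ih := tw_walk W hW β ks (List.Pairwise.of_cons hks) v₁ hv₁0 (p + (n : ℤ) • e κ)
      (fun κ' hκ' z hz1 hz2 hz3 => h κ' (List.mem_cons_of_mem κ hκ') z
        ((le_add_of_nonneg_right (zsmul_e_nonneg (by positivity) κ)).trans hz1) (by rwa [hpv] at hz2)
        (by
          have : z - p = (z - (p + (n : ℤ) • e κ)) + (n : ℤ) • e κ := by abel
          rw [this, lowPart_add, hz3, lowPart_zsmul_e_of_le (hκks κ' hκ').le, add_zero]))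
    have h1 : ‖((hol W p (seg κ n) : 𝔸ˣ) : 𝔸)‖ ≤ 1 := (mem_U1.mp (hol_mem hW _ _)).1
    have hmap : (ks.map fun κ' => ((v₁ κ').natAbs : ℝ) * β κ') = ks.map fun κ' => ((v κ').natAbs : ℝ) * β κ' :=
      List.map_congr_left fun κ' h' => by rw [hv₁κ κ' h']
    calc _ ≤ _ + _ := B8Ineq170.norm_mul_sub_one_le_of_norm_le_one h1
      _ ≤ n * β κ + (ks.map fun κ' => ((v₁ κ').natAbs : ℝ) * β κ').sum := add_le_add hseg ih
      _ = _ := by rw [hmap, hn, Int.natAbs_natCast]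

end Local

/-! ## §4 The loops of the average (42) in the tree gauge: `|V(Γ_{c,x})V(c)⁻¹ − 1| ≤ (d−1)(L−1)L·a` -/

section TransportLoops

variable {G : Type*} [Group G]

/-- A `Nodup` list of indices containing `κ` selects exactly the `κ`-block. [folklore] -/
theorem flatMap_ite_eq {ι : Type*} [DecidableEq ι] (κ : ι) (w : List (Letter d)) :
    ∀ (l : List ι), l.Nodup → κ ∈ l → l.flatMap (fun κ' => if κ' = κ then w else []) = w
  | [], _, h => by simp at h
  | a :: l, hnd, hκ => by
    rw [List.flatMap_cons]
    rcases List.mem_cons.mp hκ with h | h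
    · subst h
      rw [if_pos rfl, List.flatMap_eq_nil_iff.mpr fun κ' hκ' =>
        if_neg fun (h : κ' = κ) => (List.nodup_cons.mp hnd).1 (h ▸ hκ'), List.append_nil]
    · rw [if_neg fun (h' : a = κ) => (List.nodup_cons.mp hnd).1 (h' ▸ h), List.nil_append,
        flatMap_ite_eq κ w l (List.nodup_cons.mp hnd).2 h]

/-- The tree contour to `y + n e_κ` is the straight segment: `Γ_{y, y + n e_κ} = [y, y + n e_κ]`; in particular
`Γ_{c₋,c₊} = Γ_c` for an `L`-bond `c` (print p. 20, "straight contours"). [cite: Balaban1985Averaging, p.20] -/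
theorem treeWord_zsmul_e (n : ℤ) (κ : Fin d) : treeWord (n • e κ : Site d) = seg κ n := by
  rw [treeWord]
  have : (fun κ' : Fin d => seg κ' ((n • e κ : Site d) κ')) = fun κ' => if κ' = κ then seg κ n else [] := by
    funext κ'; rw [zsmul_e_apply]; split_ifs with h
    · rw [h]
    · rw [seg_zero]
  rw [this]
  exact flatMap_ite_eq κ _ _ (List.nodup_reverse.mpr (List.nodup_finRange d)) (by simp)

/-- In the tree gauge at `y` the straight contour `[y, y + n e_κ]` lies on the tree: holonomy `1`. [folklore] -/
theorem hol_axial_seg_base (V : Site d → Fin d → G) (y : Site d) (κ : Fin d) (n : ℤ) :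
    hol (gaugeAct (axialFn V y) V) y (seg κ n) = 1 := by
  rw [← treeWord_zsmul_e, hol_axial_treeWord]

end TransportLoops

section Loops

variable {𝔸 : Type*} [NormedRing 𝔸] [NormOneClass 𝔸]

/-- The offset of the far corner of the two-block region `B(y) ∪ B(y + Le_κ)` from `y`:
`(L−1, …, 2L−1 (coordinate κ), …, L−1)`. [cite: Balaban1985RegularSpaces, (1.23) p.79] -/
def pairTop (L : ℕ) (κ : Fin d) : Site d := fun κ' => if κ' = κ then 2 * (L : ℤ) - 1 else (L : ℤ) - 1

/-- `boxVec_nonneg` — bookkeeping. [folklore] -/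
theorem boxVec_nonneg (L : ℕ) (r : Fin d → Fin L) : (0 : Site d) ≤ boxVec L r := fun κ => by
  simp only [Pi.zero_apply, boxVec]; positivity

/-- `boxVec_add_seg_le_pairTop` — bookkeeping: `x + Le_κ` stays in the region for `x ∈ B(y)`. [folklore] -/
theorem boxVec_add_seg_le_pairTop (L : ℕ) (κ : Fin d) (r : Fin d → Fin L) :
    boxVec L r + (L : ℤ) • e κ ≤ pairTop L κ := by
  intro κ'; have := (r κ').isLt
  simp only [Pi.add_apply, boxVec, zsmul_e_apply, pairTop]
  split_ifs <;> omega

/-- `boxVec_le_pairTop` — bookkeeping. [folklore] -/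
theorem boxVec_le_pairTop (L : ℕ) (κ : Fin d) (r : Fin d → Fin L) : boxVec L r ≤ pairTop L κ := by
  intro κ'; have := (r κ').isLt
  simp only [boxVec, pairTop]
  split_ifs <;> omega

/-- **Σ**: the unit-lattice contour `[x, x + n e_κ]`, `x = y + r`, in the tree gauge at `y`:
`|V₀([x, x + n e_κ]) − 1| ≤ n · (Σ_{κ'<κ} r_{κ'}) · a`. [cite: Balaban1985Averaging, pp.24–25] -/
theorem norm_axial_seg_sub_one_le (V : Site d → Fin d → 𝔸ˣ) (hV : ∀ x κ, V x κ ∈ U1 𝔸) {lo hi : Site d}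
    {a : ℝ} (hP : PlaqSmall V lo hi a) (y r : Site d) (hr : 0 ≤ r) (κ : Fin d) (n : ℕ) (hlo : lo ≤ y)
    (hhi : y + r + (n : ℤ) • e κ ≤ hi) :
    ‖((hol (gaugeAct (axialFn V y) V) (y + r) (seg κ n) : 𝔸ˣ) : 𝔸) - 1‖ ≤ n * (l1 (lowPart κ r) * a) := by
  refine seg_walk _ (gaugeAct_mem hV (axialFn_mem hV y)) (y + r) κ n (fun j hj => ?_)
  have hyz : y ≤ y + r + (j : ℤ) • e κ :=
    (le_add_of_nonneg_right hr).trans (le_add_of_nonneg_right (zsmul_e_nonneg (by positivity) κ))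
  have hzhi : y + r + (j : ℤ) • e κ + e κ ≤ hi := by
    refine le_trans ?_ hhi
    intro κ'; simp only [Pi.add_apply, zsmul_e_apply, e_apply]; split_ifs <;> omega
  have hb := axial_bond_bound_sharp V hV hP y (y + r + (j : ℤ) • e κ) κ hlo hyz hzhi
  have : lowPart κ (y + r + (j : ℤ) • e κ - y) = lowPart κ r := by
    rw [show y + r + (j : ℤ) • e κ - y = r + (j : ℤ) • e κ by abel, lowPart_add,
      lowPart_zsmul_e_of_le le_rfl, add_zero]
  rwa [this] at hb

/-- **T**: the tree contour `Γ_{y₁, y₁ + r}` of the NEIGHBOURING block `B(y₁)`, `y₁ = y + Le_κ`, in the tree gauge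
at `y`: only its bonds of directions `κ' > κ` are off the `y`-tree, each by `L` steps of `e_κ`:
`|V₀(Γ_{y₁,y₁+r}) − 1| ≤ Σ_{κ'>κ} r_{κ'} · L · a`. [cite: Balaban1985Averaging, pp.24–25] -/
theorem norm_axial_tree_sub_one_le (V : Site d → Fin d → 𝔸ˣ) (hV : ∀ x κ, V x κ ∈ U1 𝔸) {lo hi : Site d}
    {a : ℝ} (hP : PlaqSmall V lo hi a) (y : Site d) (κ : Fin d) (L : ℕ) (r : Site d) (hr : 0 ≤ r)
    (hlo : lo ≤ y) (hhi : y + (L : ℤ) • e κ + r ≤ hi) :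
    ‖((hol (gaugeAct (axialFn V y) V) (y + (L : ℤ) • e κ) (treeWord r) : 𝔸ˣ) : 𝔸) - 1‖
      ≤ ∑ κ', ((r κ').natAbs : ℝ) * (if κ < κ' then (L : ℝ) * a else 0) := by
  have hw := tw_walk _ (gaugeAct_mem hV (axialFn_mem hV y)) (fun κ' => if κ < κ' then (L : ℝ) * a else 0)
    (List.finRange d).reverse (pairwise_gt_finRange_reverse d) r hr (y + (L : ℤ) • e κ)
    (fun κ' _ z hz1 hz2 hz3 => by
      have hyz : y ≤ z := (le_add_of_nonneg_right (zsmul_e_nonneg (by positivity) κ)).trans hz1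
      have hb := axial_bond_bound_sharp V hV hP y z κ' hlo hyz (hz2.trans hhi)
      have : lowPart κ' (z - y) = lowPart κ' ((L : ℤ) • e κ) := by
        rw [show z - y = (z - (y + (L : ℤ) • e κ)) + (L : ℤ) • e κ by abel, lowPart_add, hz3, zero_add]
      rw [this] at hb
      refine hb.trans (le_of_eq ?_)
      split_ifs with hlt
      · rw [lowPart_zsmul_e_of_lt hlt, l1_zsmul_e, Int.natAbs_natCast]
      · rw [lowPart_zsmul_e_of_le (not_lt.mp hlt), l1]; simp)
  rw [treeWord_eq_tw]
  refine hw.trans (le_of_eq ?_)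
  rw [List.map_reverse, List.sum_reverse, ← Fin.sum_univ_def]

omit [NormOneClass 𝔸] in
/-- **(42) in the tree gauge**: `V(Γ_{c,x}) V(c)⁻¹ = V₀([x, x + Le_κ]) · V₀(Γ_{c₊, x + Le_κ})⁻¹` — the two
tree pieces through `y` are `1`. [cite: Balaban1985Averaging, (42) p.23] -/
theorem Wcx_axial_eq (L : ℕ) (V : Site d → Fin d → 𝔸ˣ) (y : Site d) (κ : Fin d) (r : Site d) :
    Wcx L V y κ r = hol (gaugeAct (axialFn V y) V) (y + r) (seg κ L) *
      (hol (gaugeAct (axialFn V y) V) (y + (L : ℤ) • e κ) (treeWord r))⁻¹ := by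
  set V₀ := gaugeAct (axialFn V y) V with hV₀
  have h0 : Wcx L V y κ r = Wcx L V₀ y κ r := by
    rw [hV₀, Wcx_gaugeAct]; simp [axialFn]
  rw [h0, Wcx, gammaWord, hol_append, hol_append, disp_append, disp_treeWord, disp_seg, hol_axial_treeWord,
    one_mul, hol_revWord' V₀ (x := y + (L : ℤ) • e κ) (y + (r + (L : ℤ) • e κ)) (treeWord r)
      (by rw [disp_treeWord]; abel),
    hol_axial_seg_base, inv_one, mul_one]

/-- `offDiag κ r = Σ_{κ' ≠ κ} r_{κ'}` — bookkeeping. [folklore] -/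
def offDiag {L : ℕ} (κ : Fin d) (r : Fin d → Fin L) : ℝ := ∑ κ', if κ' = κ then (0 : ℝ) else ((r κ' : ℕ) : ℝ)

/-- `offDiag_nonneg` — bookkeeping. [folklore] -/
theorem offDiag_nonneg {L : ℕ} (κ : Fin d) (r : Fin d → Fin L) : 0 ≤ offDiag κ r :=
  Finset.sum_nonneg fun κ' _ => by split_ifs <;> positivity

/-- `offDiag_le` — bookkeeping: `Σ_{κ'≠κ} r_{κ'} ≤ (d−1)(L−1)`. [folklore] -/
theorem offDiag_le {L : ℕ} (κ : Fin d) (r : Fin d → Fin L) : offDiag κ r ≤ ((d : ℝ) - 1) * ((L : ℝ) - 1) := by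
  unfold offDiag
  have h1 : ∀ κ', (if κ' = κ then (0 : ℝ) else ((r κ' : ℕ) : ℝ))
      ≤ ((L : ℝ) - 1) - (if κ' = κ then (L : ℝ) - 1 else 0) := by
    intro κ'
    have := (r κ').isLt
    have h' : ((r κ' : ℕ) : ℝ) + 1 ≤ L := by exact_mod_cast this
    split_ifs <;> linarith
  refine (Finset.sum_le_sum fun κ' _ => h1 κ').trans (le_of_eq ?_)
  rw [Finset.sum_sub_distrib, Finset.sum_const, Finset.card_univ, Fintype.card_fin, Finset.sum_ite_eq',
    if_pos (Finset.mem_univ κ), nsmul_eq_mul]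
  ring

/-- `split_offDiag` — bookkeeping: `Σ_{κ'<κ} r_{κ'} + Σ_{κ'>κ} r_{κ'} = Σ_{κ'≠κ} r_{κ'}`. [folklore] -/
theorem split_offDiag {L : ℕ} (κ : Fin d) (r : Fin d → Fin L) :
    (l1 (lowPart κ (boxVec L r)) : ℝ) + ∑ κ', (if κ < κ' then ((r κ' : ℕ) : ℝ) else 0) = offDiag κ r := by
  rw [l1_lowPart_eq, Nat.cast_sum, offDiag, ← Finset.sum_add_distrib]
  refine Finset.sum_congr rfl fun κ' _ => ?_
  simp only [boxVec, Int.natAbs_natCast, Nat.cast_ite, Nat.cast_zero]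
  rcases lt_trichotomy κ' κ with h | h | h
  · simp [h, ne_of_lt h, lt_asymm h]
  · simp [h]
  · simp [h, ne_of_gt h, lt_asymm h]

/-- **The loops of (42) in the region of control**: for `x = y + r ∈ B(y)`,
`|V(Γ_{c,x})V(c)⁻¹ − 1| ≤ L·a·Σ_{κ'≠κ} r_{κ'} ≤ (d−1)(L−1)L·a`, assuming (1.7) only on `B(y) ∪ B(y + Le_κ)`.
(Sharper than `B7Prop2Explicit.norm_Wcx_sub_one_le`, which gives `16(d+1)(d+4)L²a`.)
[cite: Balaban1985Averaging, (42) p.23, pp.24–25] -/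
theorem norm_Wcx_sub_one_le_sharp (L : ℕ) (V : Site d → Fin d → 𝔸ˣ) (hV : ∀ x κ, V x κ ∈ U1 𝔸)
    {lo hi : Site d} {a : ℝ} (hP : PlaqSmall V lo hi a) (y : Site d) (κ : Fin d) (hlo : lo ≤ y)
    (hhi : y + pairTop L κ ≤ hi) (r : Fin d → Fin L) :
    ‖((Wcx L V y κ (boxVec L r) : 𝔸ˣ) : 𝔸) - 1‖ ≤ (L : ℝ) * a * offDiag κ r := by
  set V₀ := gaugeAct (axialFn V y) V with hV₀
  have hV₀m : ∀ x κ, V₀ x κ ∈ U1 𝔸 := gaugeAct_mem hV (axialFn_mem hV y)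
  have hhiS : y + boxVec L r + (L : ℤ) • e κ ≤ hi :=
    calc y + boxVec L r + (L : ℤ) • e κ = y + (boxVec L r + (L : ℤ) • e κ) := add_assoc _ _ _
      _ ≤ y + pairTop L κ := add_le_add le_rfl (boxVec_add_seg_le_pairTop L κ r)
      _ ≤ hi := hhi
  have hhiT : y + (L : ℤ) • e κ + boxVec L r ≤ hi := by
    rw [add_assoc, add_comm ((L : ℤ) • e κ), ← add_assoc]; exact hhiS
  have hS := norm_axial_seg_sub_one_le V hV hP y (boxVec L r) (boxVec_nonneg L r) κ L hlo hhiS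
  have hT := norm_axial_tree_sub_one_le V hV hP y κ L (boxVec L r) (boxVec_nonneg L r) hlo hhiT
  rw [Wcx_axial_eq, Units.val_mul]
  have h1 : ‖((hol V₀ (y + boxVec L r) (seg κ L) : 𝔸ˣ) : 𝔸)‖ ≤ 1 := (mem_U1.mp (hol_mem hV₀m _ _)).1
  calc _ ≤ _ + _ := B8Ineq170.norm_mul_sub_one_le_of_norm_le_one h1
    _ ≤ L * (l1 (lowPart κ (boxVec L r)) * a) +
        ∑ κ', (((boxVec L r) κ').natAbs : ℝ) * (if κ < κ' then (L : ℝ) * a else 0) :=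
      add_le_add hS ((norm_inv_sub_one_le (hol_mem hV₀m _ _)).trans hT)
    _ ≤ (L : ℝ) * a * ((l1 (lowPart κ (boxVec L r)) : ℝ) + ∑ κ', (if κ < κ' then ((r κ' : ℕ) : ℝ) else 0)) := by
      rw [mul_add, Finset.mul_sum]
      refine add_le_add (le_of_eq (by ring)) (Finset.sum_le_sum fun κ' _ => ?_)
      simp only [boxVec, Int.natAbs_natCast]
      split_ifs <;> simp [mul_comm, mul_assoc]
    _ = (L : ℝ) * a * offDiag κ r := by rw [split_offDiag]

/-- The uniform form: `|V(Γ_{c,x})V(c)⁻¹ − 1| ≤ ω := (d−1)(L−1)·L·a` (`= (d−1)(L−1)α₀/L` for `a = α₀L⁻²`).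
[cite: Balaban1985Averaging, (42) p.23] -/
def omegaC (d L : ℕ) (a : ℝ) : ℝ := (L : ℝ) * a * (((d : ℝ) - 1) * ((L : ℝ) - 1))

/-- `norm_Wcx_sub_one_le_omega`: the uniform loop bound. [cite: Balaban1985Averaging, (42) p.23] -/
theorem norm_Wcx_sub_one_le_omega (L : ℕ) (V : Site d → Fin d → 𝔸ˣ) (hV : ∀ x κ, V x κ ∈ U1 𝔸)
    {lo hi : Site d} {a : ℝ} (hP : PlaqSmall V lo hi a) (ha : 0 ≤ a) (y : Site d) (κ : Fin d) (hlo : lo ≤ y)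
    (hhi : y + pairTop L κ ≤ hi) (r : Fin d → Fin L) :
    ‖((Wcx L V y κ (boxVec L r) : 𝔸ˣ) : 𝔸) - 1‖ ≤ omegaC d L a :=
  (norm_Wcx_sub_one_le_sharp L V hV hP y κ hlo hhi r).trans
    (mul_le_mul_of_nonneg_left (offDiag_le κ r) (by positivity))

end Loops

/-! ## §5 The exponent and the average (42): `|X_c| ≤ 2ω`, `‖exp(±X_c)‖ ≤ e^{2ω}` -/

section Average

variable {𝔸 : Type*} [NormedRing 𝔸] [NormOneClass 𝔸] [NormedAlgebra ℂ 𝔸] [CompleteSpace 𝔸]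

omit [NormOneClass 𝔸] in
/-- `‖exp X‖ ≤ e^s` for `‖X‖ ≤ s` — elementary. [folklore] -/
theorem norm_exp_le_of_norm_le [NormOneClass 𝔸] (X : 𝔸) {s : ℝ} (h : ‖X‖ ≤ s) : ‖exp X‖ ≤ Real.exp s := by
  have h1 := B7Transfer.norm_exp_sub_one_le_of_le X h
  calc ‖exp X‖ = ‖(exp X - 1) + 1‖ := by rw [sub_add_cancel]
    _ ≤ ‖exp X - 1‖ + ‖(1 : 𝔸)‖ := norm_add_le _ _
    _ ≤ (Real.exp s - 1) + 1 := add_le_add h1 (le_of_eq norm_one)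
    _ = Real.exp s := by ring

/-- `(e^x)^n ≤ 1 + 2nx` for `0 ≤ x`, `nx ≤ 1` — elementary (`e^t ≤ 1 + 2t` on `[0, 1]`, the tree's
`Literature.NumberTheory.Sieve.exp_le_one_add_two_mul`, re-derived from `Real.abs_exp_sub_one_le` to keep the
import light). [folklore] -/
theorem exp_pow_le_one_add (x : ℝ) (n : ℕ) (h0 : 0 ≤ x) (h1 : (n : ℝ) * x ≤ 1) :
    Real.exp x ^ n ≤ 1 + 2 * ((n : ℝ) * x) := by
  rw [← Real.exp_nat_mul]
  have hn0 : 0 ≤ (n : ℝ) * x := by positivity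
  have h := Real.abs_exp_sub_one_le (x := (n : ℝ) * x) (by rwa [abs_of_nonneg hn0])
  rw [abs_of_nonneg hn0] at h
  have := (le_abs_self _).trans h
  linarith

/-- **The exponent of (42)**: `|X_c| ≤ 2ω` once `ω ≤ ½` (inside the domain of `log`).
[cite: Balaban1985Averaging, (42) p.23] -/
theorem norm_Xavg_le (L : ℕ) (hL : 1 ≤ L) (V : Site d → Fin d → 𝔸ˣ) (hV : ∀ x κ, V x κ ∈ U1 𝔸)
    {lo hi : Site d} {a : ℝ} (hP : PlaqSmall V lo hi a) (ha : 0 ≤ a) (y : Site d) (κ : Fin d) (hlo : lo ≤ y)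
    (hhi : y + pairTop L κ ≤ hi) (hω : omegaC d L a ≤ 1 / 2) :
    ‖Xavg L V y κ‖ ≤ 2 * omegaC d L a := by
  unfold Xavg
  refine norm_avg_le L hL _ fun r => ?_
  have hW := norm_Wcx_sub_one_le_omega L V hV hP ha y κ hlo hhi r
  exact (norm_mlog_le_two_mul (hW.trans hω)).trans (by linarith)

/-- `‖V̄_c⁻¹‖ ≤ e^{‖X_c‖}`: `V̄_c⁻¹ = V(Γ_c)⁻¹ exp(−X_c)`. [cite: Balaban1985Averaging, (42) p.23] -/
theorem norm_bavg_inv_le (L : ℕ) (V : Site d → Fin d → 𝔸ˣ) (hV : ∀ x κ, V x κ ∈ U1 𝔸) (y : Site d)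
    (κ : Fin d) {s : ℝ} (hs : ‖Xavg L V y κ‖ ≤ s) : ‖(((bavg L V y κ)⁻¹ : 𝔸ˣ) : 𝔸)‖ ≤ Real.exp s := by
  rw [bavg, mul_inv_rev, Units.val_mul, val_inv_expUnit, val_expUnit]
  calc _ ≤ ‖(((hol V y (seg κ L))⁻¹ : 𝔸ˣ) : 𝔸)‖ * ‖exp (-Xavg L V y κ)‖ := norm_mul_le _ _
    _ ≤ 1 * Real.exp s :=
      mul_le_mul (mem_U1.mp (hol_mem hV _ _)).2 (norm_exp_le_of_norm_le _ (by rwa [norm_neg])) (norm_nonneg _)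
        zero_le_one
    _ = Real.exp s := one_mul _

omit [NormOneClass 𝔸] [NormedAlgebra ℂ 𝔸] [CompleteSpace 𝔸] in
/-- `‖PZQ − 1‖ ≤ ‖P‖‖Z − 1‖‖Q‖ + ‖P − 1‖‖Q‖ + ‖Q − 1‖` — elementary. [folklore] -/
theorem norm_triple_sub_one_le (P Z Q : 𝔸) :
    ‖P * Z * Q - 1‖ ≤ ‖P‖ * ‖Z - 1‖ * ‖Q‖ + ‖P - 1‖ * ‖Q‖ + ‖Q - 1‖ := by
  have h : P * Z * Q - 1 = P * (Z - 1) * Q + ((P - 1) * Q + (Q - 1)) := by noncomm_ring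
  rw [h, add_assoc]
  refine (norm_add_le _ _).trans (add_le_add ?_ ((norm_add_le _ _).trans (add_le_add (norm_mul_le _ _) le_rfl)))
  exact (norm_mul_le _ _).trans (mul_le_mul_of_nonneg_right (norm_mul_le _ _) (norm_nonneg _))

/-- **The two straight contours compared through the averages**: with `h := U(Γ_c) V₀(Γ_c)⁻¹`,
`h = exp(−X_c[U]) · Ū_c V̄₀,c⁻¹ · exp(X_c[V₀])`, hence `|h − 1| ≤ α₁e^{3s} + e^{2s} − 1` if `|X_c[·]| ≤ s` and
`|Ū_c − V̄₀,c| ≤ α₁`. [cite: Balaban1985RegularSpaces, (1.24) p.79] -/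
theorem norm_segRatio_sub_one_le (L : ℕ) (U V₀ : Site d → Fin d → 𝔸ˣ) (hV₀ : ∀ x κ, V₀ x κ ∈ U1 𝔸)
    (y : Site d) (κ : Fin d) {s α₁ : ℝ} (hs0 : 0 ≤ s) (hsU : ‖Xavg L U y κ‖ ≤ s) (hs₀ : ‖Xavg L V₀ y κ‖ ≤ s)
    (hα₁ : 0 ≤ α₁) (havg : ‖(bavg L U y κ : 𝔸) - bavg L V₀ y κ‖ ≤ α₁) :
    ‖((hol U y (seg κ L) * (hol V₀ y (seg κ L))⁻¹ : 𝔸ˣ) : 𝔸) - 1‖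
      ≤ α₁ * Real.exp s ^ 3 + (Real.exp s ^ 2 - 1) := by
  have hid : hol U y (seg κ L) * (hol V₀ y (seg κ L))⁻¹ =
      (expUnit (Xavg L U y κ))⁻¹ * (bavg L U y κ * (bavg L V₀ y κ)⁻¹) * expUnit (Xavg L V₀ y κ) := by
    simp only [bavg, mul_inv_rev]; group
  rw [hid, Units.val_mul, Units.val_mul, val_inv_expUnit, val_expUnit, val_expUnit]
  have hZ : ‖((bavg L U y κ * (bavg L V₀ y κ)⁻¹ : 𝔸ˣ) : 𝔸) - 1‖ ≤ α₁ * Real.exp s := by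
    have : ((bavg L U y κ * (bavg L V₀ y κ)⁻¹ : 𝔸ˣ) : 𝔸) - 1
        = ((bavg L U y κ : 𝔸) - bavg L V₀ y κ) * (((bavg L V₀ y κ)⁻¹ : 𝔸ˣ) : 𝔸) := by
      rw [sub_mul, Units.mul_inv, Units.val_mul]
    rw [this]
    exact (norm_mul_le _ _).trans (mul_le_mul havg (norm_bavg_inv_le L V₀ hV₀ y κ hs₀) (norm_nonneg _) hα₁)
  set P : 𝔸 := exp (-Xavg L U y κ)
  set Q : 𝔸 := exp (Xavg L V₀ y κ)
  set Z : 𝔸 := ((bavg L U y κ * (bavg L V₀ y κ)⁻¹ : 𝔸ˣ) : 𝔸)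
  have hP : ‖P‖ ≤ Real.exp s := norm_exp_le_of_norm_le _ (by rwa [norm_neg])
  have hQ : ‖Q‖ ≤ Real.exp s := norm_exp_le_of_norm_le _ hs₀
  have hP1 : ‖P - 1‖ ≤ Real.exp s - 1 := B7Transfer.norm_exp_sub_one_le_of_le _ (by rwa [norm_neg])
  have hQ1 : ‖Q - 1‖ ≤ Real.exp s - 1 := B7Transfer.norm_exp_sub_one_le_of_le _ hs₀
  have hE : 1 ≤ Real.exp s := Real.one_le_exp hs0
  calc _ ≤ ‖P‖ * ‖Z - 1‖ * ‖Q‖ + ‖P - 1‖ * ‖Q‖ + ‖Q - 1‖ := norm_triple_sub_one_le P Z Q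
    _ ≤ Real.exp s * (α₁ * Real.exp s) * Real.exp s + (Real.exp s - 1) * Real.exp s + (Real.exp s - 1) := by
      have h1 : ‖P‖ * ‖Z - 1‖ * ‖Q‖ ≤ Real.exp s * (α₁ * Real.exp s) * Real.exp s :=
        mul_le_mul (mul_le_mul hP hZ (norm_nonneg _) (by positivity)) hQ (norm_nonneg _) (by positivity)
      have h2 : ‖P - 1‖ * ‖Q‖ ≤ (Real.exp s - 1) * Real.exp s :=
        mul_le_mul hP1 hQ (norm_nonneg _) (by linarith)
      linarith
    _ = α₁ * Real.exp s ^ 3 + (Real.exp s ^ 2 - 1) := by ring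

end Average

/-! ## §6 (1.19)–(1.21): the perturbation `V′ = U V₀⁻¹` and the covariant axial gauge condition -/

section Covariant

variable {G : Type*} [Group G]

/-- **(1.21)** p. 79, bondwise: `U = V′V₀`, i.e. `(V′V₀)_b = V′_b V₀,b`.
[cite: Balaban1985RegularSpaces, (1.21) p.79] -/
def mulCfg (V' V₀ : Site d → Fin d → G) : Site d → Fin d → G := fun x μ => V' x μ * V₀ x μ

/-- The perturbation read off from `U` and `V₀`: `V′_b = U_b V₀,b⁻¹`.
[cite: Balaban1985RegularSpaces, (1.20)–(1.21) p.79] -/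
def pert (U V₀ : Site d → Fin d → G) : Site d → Fin d → G := fun x μ => U x μ * (V₀ x μ)⁻¹

/-- `pert_mulCfg` — bookkeeping: `(V′V₀)V₀⁻¹ = V′`. [folklore] -/
@[simp] theorem pert_mulCfg (V' V₀ : Site d → Fin d → G) : pert (mulCfg V' V₀) V₀ = V' := by
  funext x μ; simp [pert, mulCfg]

/-- **(1.19)** p. 79, the covariant product along a contour of forward bonds `Γ = (b₁, …, bₙ)` from `x`:
`(R(V₀)V′)(Γ) := ∏_{b ⊂ Γ} R(V₀(Γ_{x,b₋})) V′_b`, `R(g)h = g h g⁻¹`, defined recursively by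
`(R(V₀)V′)(b₁Γ′) = V′_{b₁} · R(V₀,b₁)[(R(V₀)V′)(Γ′)]`. [cite: Balaban1985RegularSpaces, (1.19) p.79] -/
def covProd (V₀ V' : Site d → Fin d → G) : Site d → List (Letter d) → G
  | _, [] => 1
  | x, l :: w => V' x l.1 * (V₀ x l.1 * covProd V₀ V' (x + l.vec) w * (V₀ x l.1)⁻¹)

/-- **(1.19) ⟺ equality of parallel transporters**: along a contour of forward bonds,
`(V′V₀)(Γ) = (R(V₀)V′)(Γ) · V₀(Γ)`; hence `(R(V₀)V′)(Γ_{y,x}) = 1` iff `(V′V₀)(Γ_{y,x}) = V₀(Γ_{y,x})` — the form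
in which hypothesis (1.24) enters below (`Hyp.axial`). [cite: Balaban1985RegularSpaces, (1.19)–(1.21) p.79] -/
theorem hol_mulCfg_eq_covProd_mul (V₀ V' : Site d → Fin d → G) :
    ∀ (x : Site d) (w : List (Letter d)), (∀ l ∈ w, l = (l.1, true)) →
      hol (mulCfg V' V₀) x w = covProd V₀ V' x w * hol V₀ x w
  | x, [], _ => by simp [covProd]
  | x, l :: w, h => by
    have hl : l = (l.1, true) := h l (by simp)
    rw [hol_cons, hol_cons, covProd, hol_mulCfg_eq_covProd_mul V₀ V' (x + l.vec) w
      (fun l' hl' => h l' (List.mem_cons_of_mem l hl')), hl]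
    simp only [stepHol_true, mulCfg, Letter.vec_true]
    group

/-- `covProd_eq_one_iff`: `(R(V₀)V′)(Γ) = 1 ↔ (V′V₀)(Γ) = V₀(Γ)` for forward contours, in particular for the
tree contours `Γ_{y,x}`, `x ∈ B(y)` (all of whose bonds are positively oriented, `y` being the minimal corner
of `B(y)`). [cite: Balaban1985RegularSpaces, (1.19), (1.24) p.79] -/
theorem covProd_eq_one_iff (V₀ V' : Site d → Fin d → G) (x : Site d) (w : List (Letter d))
    (hw : ∀ l ∈ w, l = (l.1, true)) : covProd V₀ V' x w = 1 ↔ hol (mulCfg V' V₀) x w = hol V₀ x w := by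
  rw [hol_mulCfg_eq_covProd_mul V₀ V' x w hw, mul_eq_right]

end Covariant

/-! ## §7 Lemma 1 on the bonds of `B(c₋) ∪ B(c₊)` -/

section Lemma1

variable {𝔸 : Type*} [NormedRing 𝔸] [NormOneClass 𝔸] [NormedAlgebra ℂ 𝔸] [CompleteSpace 𝔸]

omit [NormedAlgebra ℂ 𝔸] [CompleteSpace 𝔸] in
/-- `‖pq − 1‖ ≤ ‖p − 1‖ + ‖q − 1‖` for `p ∈ U1` — elementary. [folklore] -/
theorem norm_units_mul_sub_one_le {p q : 𝔸ˣ} (hp : p ∈ U1 𝔸) :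
    ‖((p * q : 𝔸ˣ) : 𝔸) - 1‖ ≤ ‖(p : 𝔸) - 1‖ + ‖(q : 𝔸) - 1‖ := by
  rw [Units.val_mul]; exact B8Ineq170.norm_mul_sub_one_le_of_norm_le_one (mem_U1.mp hp).1

omit [NormedAlgebra ℂ 𝔸] [CompleteSpace 𝔸] in
/-- **Interior bonds** (p. 79: "The conditions `(R₀V′)(Γ_{y,x}) = 1, x ∈ B(y)`, imply `V′_b = 1` for
`b ⊂ Γ_{y,x}`. This and the above estimate imply `|V′_b − 1| < (d−1)(L−1)2α₀L⁻²` for `b ⊂ B(y)` by the same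
reasoning as in [3]"): for a bond `⟨x, x + e_μ⟩` with both axial conditions at `x` and `x + e_μ`,
`|U_b V₀,b⁻¹ − 1| ≤ 2 (Σ_{κ<μ} |x_κ − y_κ|) a` (`≤ 2(d−1)(L−1)a` on `B(y)`). [cite: Balaban1985RegularSpaces, p.79] -/
theorem interior_bound (U V₀ : Site d → Fin d → 𝔸ˣ) (hU : ∀ x κ, U x κ ∈ U1 𝔸) (hV₀ : ∀ x κ, V₀ x κ ∈ U1 𝔸)
    {lo hi : Site d} {a : ℝ} (hPU : PlaqSmall U lo hi a) (hP0 : PlaqSmall V₀ lo hi a) (y x : Site d)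
    (μ : Fin d) (hlo : lo ≤ y) (hyx : y ≤ x) (hhi : x + e μ ≤ hi) (hAx : axialFn U y x = axialFn V₀ y x)
    (hAx' : axialFn U y (x + e μ) = axialFn V₀ y (x + e μ)) :
    ‖((pert U V₀ x μ : 𝔸ˣ) : 𝔸) - 1‖ ≤ 2 * (l1 (lowPart μ (x - y)) * a) := by
  have hid : pert U V₀ x μ = (axialFn V₀ y x)⁻¹ *
      (gaugeAct (axialFn U y) U x μ * (gaugeAct (axialFn V₀ y) V₀ x μ)⁻¹) * axialFn V₀ y x := by
    simp only [pert, gaugeAct, hAx, hAx']; group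
  rw [hid, Units.val_mul, Units.val_mul]
  refine (norm_units_inv_conj_sub_one_le (axialFn_mem hV₀ y x) _).trans ?_
  have h1 := axial_bond_bound_sharp U hU hPU y x μ hlo hyx hhi
  have h2 := axial_bond_bound_sharp V₀ hV₀ hP0 y x μ hlo hyx hhi
  calc _ ≤ _ + _ := norm_units_mul_sub_one_le (gaugeAct_mem hU (axialFn_mem hU y) x μ)
    _ ≤ _ + _ := add_le_add h1 ((norm_inv_sub_one_le (gaugeAct_mem hV₀ (axialFn_mem hV₀ y) x μ)).trans h2)
    _ = _ := by ring

omit [NormOneClass 𝔸] [NormedAlgebra ℂ 𝔸] [CompleteSpace 𝔸] in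
/-- **T-factor** of the crossing bonds: the tree contour `Γ_{c₊,x′}` of the neighbouring block `B(c₊)`,
`c₊ = y + Le_κ`, in the tree gauge at `y`. [cite: Balaban1985RegularSpaces, p.79] -/
def Tfac (L : ℕ) (V : Site d → Fin d → 𝔸ˣ) (y : Site d) (κ : Fin d) (x' : Site d) : 𝔸ˣ :=
  hol (gaugeAct (axialFn V y) V) (y + (L : ℤ) • e κ) (treeWord (x' - (y + (L : ℤ) • e κ)))

omit [NormOneClass 𝔸] [NormedAlgebra ℂ 𝔸] [CompleteSpace 𝔸] in
/-- `Tfac_eq`: `V₀(Γ_{c₊,x′}) = V(Γ_c) · V(Γ_{c₊,x′}) · V(Γ_{y,x′})⁻¹` (the two tree systems compared).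
[cite: Balaban1985RegularSpaces, p.79] -/
theorem Tfac_eq (L : ℕ) (V : Site d → Fin d → 𝔸ˣ) (y : Site d) (κ : Fin d) (x' : Site d) :
    Tfac L V y κ x' = hol V y (seg κ L) * axialFn V (y + (L : ℤ) • e κ) x' * (axialFn V y x')⁻¹ := by
  rw [Tfac, hol_gaugeAct, disp_treeWord, add_sub_cancel]
  simp only [axialFn, add_sub_cancel_left, treeWord_zsmul_e]

omit [NormOneClass 𝔸] [NormedAlgebra ℂ 𝔸] [CompleteSpace 𝔸] in
/-- **The crossing identity** (the bonds `b₀, b′, b″ ∈ B(c)` of p. 79 joining `B(c₋)` to `B(c₊)`): for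
`b = ⟨x, x + e_κ⟩` with `x ∈ B(y)`, `x + e_κ ∈ B(y + Le_κ)` and the axial conditions at `x` (tree at `y`) and at
`x + e_κ` (tree at `y + Le_κ`),
`V′_b = V₀(Γ_{y,x})⁻¹ · [U₀,b · T_U⁻¹ · U(Γ_c)V₀(Γ_c)⁻¹ · T_{V₀} · (V₀)₀,b⁻¹] · V₀(Γ_{y,x})`
(subscript `₀` = tree gauge at `y`). Pure algebra. [cite: Balaban1985RegularSpaces, (1.19)–(1.21) p.79] -/
theorem crossing_identity (L : ℕ) (U V₀ : Site d → Fin d → 𝔸ˣ) (y x : Site d) (κ : Fin d)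
    (hAx : axialFn U y x = axialFn V₀ y x)
    (hAx₁ : axialFn U (y + (L : ℤ) • e κ) (x + e κ) = axialFn V₀ (y + (L : ℤ) • e κ) (x + e κ)) :
    pert U V₀ x κ = (axialFn V₀ y x)⁻¹ *
      (gaugeAct (axialFn U y) U x κ * (Tfac L U y κ (x + e κ))⁻¹ *
        (hol U y (seg κ L) * (hol V₀ y (seg κ L))⁻¹) * Tfac L V₀ y κ (x + e κ) *
        (gaugeAct (axialFn V₀ y) V₀ x κ)⁻¹) * axialFn V₀ y x := by
  rw [Tfac_eq, Tfac_eq]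
  simp only [pert, gaugeAct]
  rw [hAx, hAx₁]
  group

omit [NormOneClass 𝔸] [NormedAlgebra ℂ 𝔸] [CompleteSpace 𝔸] in
/-- `boxVec_add_e_self_le_pairTop` — bookkeeping: the far end of a crossing bond is in the region. [folklore] -/
theorem boxVec_add_e_le_pairTop {L : ℕ} (κ : Fin d) (r : Fin d → Fin L) : boxVec L r + e κ ≤ pairTop L κ := by
  intro κ'; have := (r κ').isLt
  simp only [Pi.add_apply, boxVec, e_apply, pairTop]
  split_ifs <;> omega

omit [NormOneClass 𝔸] [NormedAlgebra ℂ 𝔸] [CompleteSpace 𝔸] in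
/-- `bracket_le_omega` — bookkeeping: `(Σ_{κ'<κ} r_{κ'})a + Σ_{κ'>κ} r′_{κ'}·L·a ≤ ω` when `r′ = r` off `κ`.
[folklore] -/
theorem bracket_le_omega {L : ℕ} (hL : 1 ≤ L) (κ : Fin d) (r r' : Fin d → Fin L)
    (hr' : ∀ κ', κ' ≠ κ → r' κ' = r κ') {a : ℝ} (ha : 0 ≤ a) :
    (l1 (lowPart κ (boxVec L r)) : ℝ) * a +
        ∑ κ', (((boxVec L r') κ').natAbs : ℝ) * (if κ < κ' then (L : ℝ) * a else 0) ≤ omegaC d L a := by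
  have hsum : ∑ κ', (((boxVec L r') κ').natAbs : ℝ) * (if κ < κ' then (L : ℝ) * a else 0)
      = (L : ℝ) * a * ∑ κ', (if κ < κ' then ((r κ' : ℕ) : ℝ) else 0) := by
    rw [Finset.mul_sum]
    refine Finset.sum_congr rfl fun κ' _ => ?_
    simp only [boxVec, Int.natAbs_natCast]
    split_ifs with h
    · rw [hr' κ' (ne_of_gt h)]; ring
    · simp
  have hl1 : (l1 (lowPart κ (boxVec L r)) : ℝ) * a ≤ (L : ℝ) * a * (l1 (lowPart κ (boxVec L r)) : ℝ) := by
    have hL1 : (1 : ℝ) ≤ L := by exact_mod_cast hL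
    have h0 : 0 ≤ ((L : ℝ) - 1) * a * (l1 (lowPart κ (boxVec L r)) : ℝ) :=
      mul_nonneg (mul_nonneg (by linarith) ha) (Nat.cast_nonneg _)
    nlinarith
  rw [hsum]
  calc _ ≤ (L : ℝ) * a * ((l1 (lowPart κ (boxVec L r)) : ℝ) + ∑ κ', (if κ < κ' then ((r κ' : ℕ) : ℝ) else 0)) := by
        rw [mul_add]; exact add_le_add hl1 le_rfl
    _ = (L : ℝ) * a * offDiag κ r := by rw [split_offDiag]
    _ ≤ omegaC d L a := mul_le_mul_of_nonneg_left (offDiag_le κ r) (by positivity)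

omit [NormOneClass 𝔸] [NormedAlgebra ℂ 𝔸] [CompleteSpace 𝔸] in
/-- `l1_lowPart_boxVec_le` — bookkeeping: `Σ_{κ<μ} r_κ ≤ (d−1)(L−1)`. [folklore] -/
theorem l1_lowPart_boxVec_le {L : ℕ} (μ : Fin d) (r : Fin d → Fin L) :
    (l1 (lowPart μ (boxVec L r)) : ℝ) ≤ ((d : ℝ) - 1) * ((L : ℝ) - 1) := by
  have h1 := split_offDiag μ r
  have h2 := offDiag_le μ r
  have h3 : 0 ≤ ∑ κ', (if μ < κ' then ((r κ' : ℕ) : ℝ) else 0) :=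
    Finset.sum_nonneg fun κ' _ => by split_ifs <;> positivity
  linarith

/-- **Crossing bonds** (p. 79, the bonds `b₀, b′, b″` of `B(c)` (1.23)): for `b = ⟨x, x + e_κ⟩`, `x = y + r ∈ B(y)`
with `r_κ = L − 1`, `|V′_b − 1| ≤ 2ω + (α₁e^{3s} + e^{2s} − 1)` where `|X_c[U]|, |X_c[V₀]| ≤ s`.
[cite: Balaban1985RegularSpaces, Lemma 1 p.79] -/
theorem crossing_bound {L : ℕ} (U V₀ : Site d → Fin d → 𝔸ˣ) (hU : ∀ x κ, U x κ ∈ U1 𝔸)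
    (hV₀ : ∀ x κ, V₀ x κ ∈ U1 𝔸) {lo hi : Site d} {a : ℝ} (hPU : PlaqSmall U lo hi a) (hP0 : PlaqSmall V₀ lo hi a)
    (ha : 0 ≤ a) (y : Site d) (κ : Fin d) (hlo : lo ≤ y) (hhi : y + pairTop L κ ≤ hi) (r : Fin d → Fin L)
    (hr : (r κ : ℕ) + 1 = L) (hAx : axialFn U y (y + boxVec L r) = axialFn V₀ y (y + boxVec L r))
    (hAx₁ : axialFn U (y + (L : ℤ) • e κ) (y + boxVec L r + e κ)
      = axialFn V₀ (y + (L : ℤ) • e κ) (y + boxVec L r + e κ))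
    {s α₁ : ℝ} (hs0 : 0 ≤ s) (hsU : ‖Xavg L U y κ‖ ≤ s) (hs₀ : ‖Xavg L V₀ y κ‖ ≤ s) (hα₁ : 0 ≤ α₁)
    (havg : ‖(bavg L U y κ : 𝔸) - bavg L V₀ y κ‖ ≤ α₁) :
    ‖((pert U V₀ (y + boxVec L r) κ : 𝔸ˣ) : 𝔸) - 1‖
      ≤ 2 * omegaC d L a + (α₁ * Real.exp s ^ 3 + (Real.exp s ^ 2 - 1)) := by
  have hL : 1 ≤ L := by omega
  set x := y + boxVec L r with hx
  set y₁ := y + (L : ℤ) • e κ with hy₁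
  -- the offset of `x + e κ` in `B(y₁)`
  set r' : Fin d → Fin L := Function.update r κ ⟨0, by omega⟩ with hr'
  have hr'κ : ∀ κ', κ' ≠ κ → r' κ' = r κ' := fun κ' h => by simp [hr', h]
  have hx' : x + e κ = y₁ + boxVec L r' := by
    funext κ'
    simp only [hx, hy₁, Pi.add_apply, boxVec, e_apply, zsmul_e_apply, hr']
    by_cases h : κ' = κ
    · subst h; simp; omega
    · simp [h]
  have hyx : y ≤ x := le_add_of_nonneg_right (boxVec_nonneg L r)
  have hxe : x + e κ ≤ hi := by
    refine le_trans ?_ hhi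
    rw [hx, add_assoc]
    exact add_le_add le_rfl (boxVec_add_e_le_pairTop κ r)
  have h1U := axial_bond_bound_sharp U hU hPU y x κ hlo hyx hxe
  have h10 := axial_bond_bound_sharp V₀ hV₀ hP0 y x κ hlo hyx hxe
  rw [hx, add_sub_cancel_left, ← hx] at h1U h10
  have hx'hi : y + (L : ℤ) • e κ + boxVec L r' ≤ hi := by rw [← hy₁, ← hx']; exact hxe
  have hTU := norm_axial_tree_sub_one_le U hU hPU y κ L (boxVec L r') (boxVec_nonneg L r') hlo hx'hi
  have hT0 := norm_axial_tree_sub_one_le V₀ hV₀ hP0 y κ L (boxVec L r') (boxVec_nonneg L r') hlo hx'hi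
  have hh := norm_segRatio_sub_one_le L U V₀ hV₀ y κ hs0 hsU hs₀ hα₁ havg
  have hTf : ∀ V : Site d → Fin d → 𝔸ˣ,
      Tfac L V y κ (x + e κ) = hol (gaugeAct (axialFn V y) V) y₁ (treeWord (boxVec L r')) := by
    intro V; rw [Tfac, ← hy₁, hx', add_sub_cancel_left]
  rw [crossing_identity L U V₀ y x κ hAx hAx₁, Units.val_mul, Units.val_mul]
  refine (norm_units_inv_conj_sub_one_le (axialFn_mem hV₀ y x) _).trans ?_
  have mUy : ∀ z μ, gaugeAct (axialFn U y) U z μ ∈ U1 𝔸 := gaugeAct_mem hU (axialFn_mem hU y)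
  have m0y : ∀ z μ, gaugeAct (axialFn V₀ y) V₀ z μ ∈ U1 𝔸 := gaugeAct_mem hV₀ (axialFn_mem hV₀ y)
  have mTU : Tfac L U y κ (x + e κ) ∈ U1 𝔸 := by rw [hTf]; exact hol_mem mUy _ _
  have mT0 : Tfac L V₀ y κ (x + e κ) ∈ U1 𝔸 := by rw [hTf]; exact hol_mem m0y _ _
  have mh : hol U y (seg κ L) * (hol V₀ y (seg κ L))⁻¹ ∈ U1 𝔸 :=
    (U1 𝔸).mul_mem (hol_mem hU _ _) ((U1 𝔸).inv_mem (hol_mem hV₀ _ _))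
  have hbr := bracket_le_omega (d := d) hL κ r r' hr'κ ha
  calc _ ≤ ‖((gaugeAct (axialFn U y) U x κ : 𝔸ˣ) : 𝔸) - 1‖
          + ‖(((Tfac L U y κ (x + e κ))⁻¹ : 𝔸ˣ) : 𝔸) - 1‖
          + ‖((hol U y (seg κ L) * (hol V₀ y (seg κ L))⁻¹ : 𝔸ˣ) : 𝔸) - 1‖
          + ‖((Tfac L V₀ y κ (x + e κ) : 𝔸ˣ) : 𝔸) - 1‖
          + ‖(((gaugeAct (axialFn V₀ y) V₀ x κ)⁻¹ : 𝔸ˣ) : 𝔸) - 1‖ := by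
        refine (norm_units_mul_sub_one_le ?_).trans (add_le_add ((norm_units_mul_sub_one_le ?_).trans
          (add_le_add ((norm_units_mul_sub_one_le ?_).trans (add_le_add (norm_units_mul_sub_one_le (mUy x κ))
          le_rfl)) le_rfl)) le_rfl)
        · exact (U1 𝔸).mul_mem ((U1 𝔸).mul_mem ((U1 𝔸).mul_mem (mUy x κ) ((U1 𝔸).inv_mem mTU)) mh) mT0
        · exact (U1 𝔸).mul_mem ((U1 𝔸).mul_mem (mUy x κ) ((U1 𝔸).inv_mem mTU)) mh
        · exact (U1 𝔸).mul_mem (mUy x κ) ((U1 𝔸).inv_mem mTU)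
    _ ≤ l1 (lowPart κ (boxVec L r)) * a
          + ∑ κ', (((boxVec L r') κ').natAbs : ℝ) * (if κ < κ' then (L : ℝ) * a else 0)
          + (α₁ * Real.exp s ^ 3 + (Real.exp s ^ 2 - 1))
          + ∑ κ', (((boxVec L r') κ').natAbs : ℝ) * (if κ < κ' then (L : ℝ) * a else 0)
          + l1 (lowPart κ (boxVec L r)) * a := by
        refine add_le_add (add_le_add (add_le_add (add_le_add h1U ?_) hh) ?_) ?_
        · exact (norm_inv_sub_one_le mTU).trans (by rw [hTf]; exact hTU)
        · rw [hTf]; exact hT0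
        · exact (norm_inv_sub_one_le (m0y x κ)).trans h10
    _ ≤ 2 * omegaC d L a + (α₁ * Real.exp s ^ 3 + (Real.exp s ^ 2 - 1)) := by linarith

/-! ### The two blocks `B(c₋) = B(y)`, `B(c₊) = B(y + Le_κ)` and the hypotheses of Lemma 1 -/

omit [NormOneClass 𝔸] [NormedAlgebra ℂ 𝔸] [CompleteSpace 𝔸]

/-- `inBlock_iff`: `x ∈ B(y) = {x : y_μ ≤ x_μ < y_μ + L}` (`B8Lemma1Lattice.InBlock`, the corner blocks of
[Balaban1985Averaging] p. 18, B5 (1.6)) `↔ x = y + r`, `r ∈ [0, L)^d` (`B7Prop1Explicit.boxVec`). [folklore] -/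
theorem inBlock_iff (L : ℕ) (y x : Site d) : InBlock L y x ↔ ∃ r : Fin d → Fin L, x = y + boxVec L r := by
  constructor
  · intro h
    refine ⟨fun κ => ⟨(x κ - y κ).toNat, by have := h κ; omega⟩, ?_⟩
    funext κ; have := h κ; simp only [Pi.add_apply, boxVec]; omega
  · rintro ⟨r, rfl⟩ κ; have := (r κ).isLt; simp only [Pi.add_apply, boxVec]; omega

/-- `x ∈ B(c₋) ∪ B(c₊)` for `c = ⟨y, y + Le_κ⟩`. [cite: Balaban1985RegularSpaces, (1.23) p.79] -/
def InPair (L : ℕ) (y : Site d) (κ : Fin d) (x : Site d) : Prop :=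
  InBlock L y x ∨ InBlock L (y + (L : ℤ) • e κ) x

end Lemma1

section Lemma1Main

variable {𝔸 : Type*} [NormedRing 𝔸] [NormOneClass 𝔸] [NormedAlgebra ℂ 𝔸] [CompleteSpace 𝔸]

/-- **The hypotheses of Lemma 1 for one coarse bond `c = ⟨y, y + Le_κ⟩`** (p. 79): `V₀` and `U = V′V₀` take
values in `U1 𝔸` and satisfy (1.7) for `k = 1`, `|V(∂p) − 1| ≤ a` (`a = α₀L⁻²`), for the plaquettes of
`B(c₋) ∪ B(c₊)` (`plaqU`, `plaqV₀`); (1.24): the axial conditions `(R(V₀)V′)(Γ_{z,x}) = 1`, `x ∈ B(z)`, for both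
blocks `z = c₋, c₊` in the equivalent form `U(Γ_{z,x}) = V₀(Γ_{z,x})` (`covProd_eq_one_iff`), and
`|Ū_c − V̄₀,c| ≤ α₁` for the averages (42) of [Balaban1985Averaging].
[cite: Balaban1985RegularSpaces, (1.7) p.77, (1.24) p.79] -/
structure Hyp (L : ℕ) (U V₀ : Site d → Fin d → 𝔸ˣ) (y : Site d) (κ : Fin d) (a α₁ : ℝ) : Prop where
  memU : ∀ x μ, U x μ ∈ U1 𝔸
  memV₀ : ∀ x μ, V₀ x μ ∈ U1 𝔸
  plaqU : PlaqSmall U y (y + pairTop L κ) a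
  plaqV₀ : PlaqSmall V₀ y (y + pairTop L κ) a
  axial : ∀ r : Fin d → Fin L, axialFn U y (y + boxVec L r) = axialFn V₀ y (y + boxVec L r)
  axial₁ : ∀ r : Fin d → Fin L, axialFn U (y + (L : ℤ) • e κ) (y + (L : ℤ) • e κ + boxVec L r)
    = axialFn V₀ (y + (L : ℤ) • e κ) (y + (L : ℤ) • e κ + boxVec L r)
  avg : ‖(bavg L U y κ : 𝔸) - bavg L V₀ y κ‖ ≤ α₁

omit [NormOneClass 𝔸] [NormedAlgebra ℂ 𝔸] [CompleteSpace 𝔸] in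
/-- `omegaC_nonneg` — bookkeeping. [folklore] -/
theorem omegaC_nonneg {L : ℕ} (hL : 1 ≤ L) (hd : 1 ≤ d) {a : ℝ} (ha : 0 ≤ a) : 0 ≤ omegaC d L a := by
  unfold omegaC
  have h1 : (1 : ℝ) ≤ L := by exact_mod_cast hL
  have h2 : (1 : ℝ) ≤ d := by exact_mod_cast hd
  have : 0 ≤ ((d : ℝ) - 1) * ((L : ℝ) - 1) := mul_nonneg (by linarith) (by linarith)
  positivity

/-- **Lemma 1, explicit form, every bond of `B(c₋) ∪ B(c₊)`**: under `Hyp` with `6ω ≤ 1`,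
`ω = (d−1)(L−1)·L·a`, every bond `b` with both ends in `B(c₋) ∪ B(c₊)` has
`|V′_b − 1| ≤ α₁ + ω(10 + 12α₁)`. [cite: Balaban1985RegularSpaces, Lemma 1 pp.79–80] -/
theorem lemma1_explicit {L : ℕ} (hL : 1 ≤ L) {U V₀ : Site d → Fin d → 𝔸ˣ} {y : Site d} {κ : Fin d}
    {a α₁ : ℝ} (H : Hyp L U V₀ y κ a α₁) (ha : 0 ≤ a) (hα₁ : 0 ≤ α₁) (hω : 6 * omegaC d L a ≤ 1)
    (x : Site d) (ν : Fin d) (hx : InPair L y κ x) (hxν : InPair L y κ (x + e ν)) :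
    ‖((pert U V₀ x ν : 𝔸ˣ) : 𝔸) - 1‖ ≤ α₁ + omegaC d L a * (10 + 12 * α₁) := by
  have hd : 1 ≤ d := Nat.one_le_iff_ne_zero.mpr (fun h => by subst h; exact Fin.elim0 κ)
  set ω := omegaC d L a with hωdef
  have hω0 : 0 ≤ ω := omegaC_nonneg hL hd ha
  have hy₁ : y ≤ y + (L : ℤ) • e κ := le_add_of_nonneg_right (zsmul_e_nonneg (by positivity) κ)
  have hNN : 2 * (((d : ℝ) - 1) * ((L : ℝ) - 1) * a) ≤ α₁ + ω * (10 + 12 * α₁) := by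
    have h1 : (1 : ℝ) ≤ L := by exact_mod_cast hL
    have h2 : (1 : ℝ) ≤ d := by exact_mod_cast hd
    have h3 : 0 ≤ ((d : ℝ) - 1) * ((L : ℝ) - 1) * a := by
      have := mul_nonneg (by linarith : (0 : ℝ) ≤ d - 1) (by linarith : (0 : ℝ) ≤ L - 1); positivity
    have h4 : ((d : ℝ) - 1) * ((L : ℝ) - 1) * a ≤ ω := by
      rw [hωdef, omegaC]; nlinarith
    nlinarith
  -- interior bonds of a block based at `z ∈ {y, y + Le_κ}`
  have interior : ∀ z : Site d, y ≤ z → z + pairTop L κ ≤ y + pairTop L κ ∨ True →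
      (∀ r : Fin d → Fin L, axialFn U z (z + boxVec L r) = axialFn V₀ z (z + boxVec L r)) →
      ∀ (r r'' : Fin d → Fin L), x = z + boxVec L r → x + e ν = z + boxVec L r'' →
      z + boxVec L r'' ≤ y + pairTop L κ →
      ‖((pert U V₀ x ν : 𝔸ˣ) : 𝔸) - 1‖ ≤ α₁ + ω * (10 + 12 * α₁) := by
    intro z hyz _ hax r r'' hxr hxr'' hhi
    have hb := interior_bound U V₀ H.memU H.memV₀ H.plaqU H.plaqV₀ z x ν hyz
      (by rw [hxr]; exact le_add_of_nonneg_right (boxVec_nonneg L r)) (by rw [hxr'']; exact hhi)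
      (by rw [hxr]; exact hax r) (by rw [hxr'']; exact hax r'')
    rw [hxr, add_sub_cancel_left] at hb
    have hl := l1_lowPart_boxVec_le (d := d) ν r
    refine (hxr ▸ hb).trans (le_trans ?_ hNN)
    nlinarith
  rcases hx with hx | hx <;> rcases hxν with hxν | hxν
  · -- both ends in `B(c₋)`
    obtain ⟨r, hr⟩ := (inBlock_iff L y x).mp hx
    obtain ⟨r'', hr''⟩ := (inBlock_iff L y (x + e ν)).mp hxν
    exact interior y le_rfl (Or.inr trivial) H.axial r r'' hr hr''
      (add_le_add le_rfl (boxVec_le_pairTop L κ r''))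
  · -- `x ∈ B(c₋)`, `x + e ν ∈ B(c₊)`: a crossing bond, `ν = κ`
    obtain ⟨r, hr⟩ := (inBlock_iff L y x).mp hx
    have hνκ : ν = κ := by
      by_contra h
      have h1 := (hx κ).2
      have h2 := (hxν κ).1
      simp only [Pi.add_apply, zsmul_e_apply_self, e_apply_of_ne (Ne.symm h)] at h2
      omega
    subst hνκ
    have hrκ : (r ν : ℕ) + 1 = L := by
      have h1 := (hx ν).2
      have h2 := (hxν ν).1
      rw [hr] at h1 h2
      simp only [Pi.add_apply, zsmul_e_apply_self, e_apply_self, boxVec] at h1 h2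
      omega
    obtain ⟨r'', hr''⟩ := (inBlock_iff L _ (x + e ν)).mp hxν
    have hω2 : ω ≤ 1 / 2 := by linarith
    have hsU := norm_Xavg_le L hL U H.memU H.plaqU ha y ν le_rfl le_rfl hω2
    have hs0 := norm_Xavg_le L hL V₀ H.memV₀ H.plaqV₀ ha y ν le_rfl le_rfl hω2
    have hAx₁ : axialFn U (y + (L : ℤ) • e ν) (y + boxVec L r + e ν)
        = axialFn V₀ (y + (L : ℤ) • e ν) (y + boxVec L r + e ν) := by
      rw [← hr, hr'']; exact H.axial₁ r''
    have hc := crossing_bound U V₀ H.memU H.memV₀ H.plaqU H.plaqV₀ ha y ν le_rfl le_rfl r hrκ (H.axial r)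
      hAx₁ (by positivity) hsU hs0 hα₁ H.avg
    rw [← hr] at hc
    refine hc.trans ?_
    -- numerics: `s = 2ω`, `3s ≤ 1`
    have e3 : Real.exp (2 * ω) ^ 3 ≤ 1 + 12 * ω := by
      have := exp_pow_le_one_add (2 * ω) 3 (by positivity) (by push_cast; linarith)
      push_cast at this; linarith
    have e2 : Real.exp (2 * ω) ^ 2 ≤ 1 + 8 * ω := by
      have := exp_pow_le_one_add (2 * ω) 2 (by positivity) (by push_cast; linarith)
      push_cast at this; linarith
    nlinarith [mul_le_mul_of_nonneg_left e3 hα₁]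
  · -- `x ∈ B(c₊)`, `x + e ν ∈ B(c₋)`: impossible
    exfalso
    have h1 := (hx κ).1
    have h2 := (hxν κ).2
    simp only [Pi.add_apply, zsmul_e_apply_self, e_apply] at h1 h2
    split_ifs at h2 <;> omega
  · -- both ends in `B(c₊)`
    obtain ⟨r, hr⟩ := (inBlock_iff L _ x).mp hx
    obtain ⟨r'', hr''⟩ := (inBlock_iff L _ (x + e ν)).mp hxν
    exact interior (y + (L : ℤ) • e κ) hy₁ (Or.inr trivial) H.axial₁ r r'' hr hr''
      (by rw [add_assoc]; exact add_le_add le_rfl (by rw [add_comm]; exact boxVec_add_seg_le_pairTop L κ r''))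

/-- **Lemma 1 with the printed constant** (1.25): for `a = α₀L⁻²`, `0 < α₀ ≤ 1/(6(d+1))`, `0 ≤ α₁ ≤ 1/6`,
every bond `b ⊂ B(c₋) ∪ B(c₊)` has `|V′_b − 1| < 4d²α₀ + α₁` (indeed `≤ α₁ + 12(d−1)(L−1)α₀/L`).
[cite: Balaban1985RegularSpaces, Lemma 1 (1.25) p.79] -/
theorem lemma1_printedBound {L : ℕ} (hL : 1 ≤ L) {U V₀ : Site d → Fin d → 𝔸ˣ} {y : Site d} {κ : Fin d}
    {α₀ α₁ : ℝ} (H : Hyp L U V₀ y κ (α₀ / (L : ℝ) ^ 2) α₁) (hα₀ : 0 < α₀) (hα₀' : α₀ ≤ 1 / (6 * ((d : ℝ) + 1)))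
    (hα₁ : 0 ≤ α₁) (hα₁' : α₁ ≤ 1 / 6) (x : Site d) (ν : Fin d) (hx : InPair L y κ x)
    (hxν : InPair L y κ (x + e ν)) :
    ‖((pert U V₀ x ν : 𝔸ˣ) : 𝔸) - 1‖ < 4 * (d : ℝ) ^ 2 * α₀ + α₁ := by
  have hd : 1 ≤ d := Nat.one_le_iff_ne_zero.mpr (fun h => by subst h; exact Fin.elim0 κ)
  have h1 : (1 : ℝ) ≤ L := by exact_mod_cast hL
  have h2 : (1 : ℝ) ≤ d := by exact_mod_cast hd
  have hLpos : (0 : ℝ) < L := by linarith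
  -- `ω = (d−1)(L−1)α₀/L ≤ (d−1)α₀`
  have hωle : omegaC d L (α₀ / (L : ℝ) ^ 2) ≤ ((d : ℝ) - 1) * α₀ := by
    unfold omegaC
    rw [show (L : ℝ) * (α₀ / (L : ℝ) ^ 2) * (((d : ℝ) - 1) * ((L : ℝ) - 1))
      = ((d : ℝ) - 1) * α₀ * (((L : ℝ) - 1) / L) by field_simp]
    have : ((L : ℝ) - 1) / L ≤ 1 := by rw [div_le_one hLpos]; linarith
    have h0 : 0 ≤ ((d : ℝ) - 1) * α₀ := mul_nonneg (by linarith) hα₀.le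
    nlinarith
  have hdα : ((d : ℝ) - 1) * α₀ ≤ 1 / 6 := by
    have hd1 : (0 : ℝ) < 6 * ((d : ℝ) + 1) := by positivity
    calc ((d : ℝ) - 1) * α₀ ≤ ((d : ℝ) + 1) * α₀ := by nlinarith [hα₀.le]
      _ ≤ ((d : ℝ) + 1) * (1 / (6 * ((d : ℝ) + 1))) := mul_le_mul_of_nonneg_left hα₀' (by linarith)
      _ = 1 / 6 := by field_simp
  have hω : 6 * omegaC d L (α₀ / (L : ℝ) ^ 2) ≤ 1 := by linarith
  have hb := lemma1_explicit hL H (by positivity) hα₁ hω x ν hx hxν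
  have hω0 : 0 ≤ omegaC d L (α₀ / (L : ℝ) ^ 2) := omegaC_nonneg hL hd (by positivity)
  -- `12(d−1) ≤ 4d² − 4` for natural `d`
  have hdd : (0 : ℝ) ≤ ((d : ℝ) - 1) * ((d : ℝ) - 2) := by
    rcases Nat.lt_or_ge d 2 with h | h
    · have h1' : d = 1 := by omega
      subst h1'; norm_num
    · have : (2 : ℝ) ≤ d := by exact_mod_cast h
      exact mul_nonneg (by linarith) (by linarith)
  refine hb.trans_lt ?_
  nlinarith [mul_le_mul_of_nonneg_left hα₁' hω0]

end Lemma1Main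

/-! ## §8 The DAG leaf `B8.Lemma1Printed d fam` for the NON-ABELIAN carriers `blockPairNA d L 𝔸` -/

section Leaf

variable {𝔸 : Type*} [NormedRing 𝔸] [NormOneClass 𝔸] [NormedAlgebra ℂ 𝔸] [CompleteSpace 𝔸]

omit [NormOneClass 𝔸] [NormedAlgebra ℂ 𝔸] [CompleteSpace 𝔸] in
/-- (1.7) for `k = 1` with the printed STRICT inequality, on the plaquettes of `[lo, hi]`.
[cite: Balaban1985RegularSpaces, (1.7) p.77] -/
def PlaqSmallLT (V : Site d → Fin d → 𝔸ˣ) (lo hi : Site d) (a : ℝ) : Prop :=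
  ∀ (x : Site d) (κ μ : Fin d), κ ≠ μ → lo ≤ x → x + e κ + e μ ≤ hi →
    ‖((hol V x (plaqWord κ μ) : 𝔸ˣ) : 𝔸) - 1‖ < a

omit [NormOneClass 𝔸] [NormedAlgebra ℂ 𝔸] [CompleteSpace 𝔸] in
/-- `PlaqSmallLT.le` — bookkeeping. [folklore] -/
theorem PlaqSmallLT.le {V : Site d → Fin d → 𝔸ˣ} {lo hi : Site d} {a : ℝ} (h : PlaqSmallLT V lo hi a) :
    PlaqSmall V lo hi a := fun x κ μ h1 h2 h3 => (h x κ μ h1 h2 h3).le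

/-- **`small α₀ V₀ V′`** of the carrier: `V₀`, `V′` are `G = U1 𝔸`-valued and `V₀`, `V′V₀` satisfy (1.7) for `k = 1`,
`|V(∂p) − 1| < α₀L⁻²`, on the plaquettes of `B(c₋) ∪ B(c₊)`, `c = ⟨y, y + Le_κ⟩`.
[cite: Balaban1985RegularSpaces, (1.7) p.77, Lemma 1 p.79] -/
def Small (L : ℕ) (y : Site d) (κ : Fin d) (α₀ : ℝ) (V₀ V' : Site d → Fin d → 𝔸ˣ) : Prop :=
  (∀ x μ, V₀ x μ ∈ U1 𝔸) ∧ (∀ x μ, V' x μ ∈ U1 𝔸) ∧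
    PlaqSmallLT V₀ y (y + pairTop L κ) (α₀ / (L : ℝ) ^ 2) ∧
    PlaqSmallLT (mulCfg V' V₀) y (y + pairTop L κ) (α₀ / (L : ℝ) ^ 2)

/-- **`axialClose α₁ V₀ V′`** of the carrier = (1.24) on `B(c₋) ∪ B(c₊)`: `(R(V₀)V′)(Γ_{z,x}) = 1`, `x ∈ B(z)`,
`z ∈ {c₋, c₊}` (in the form `(V′V₀)(Γ_{z,x}) = V₀(Γ_{z,x})`, `covProd_eq_one_iff`), and
`|\overline{V′V₀}_c − V̄₀,c| < α₁`
for the averages (42) of [Balaban1985Averaging]. [cite: Balaban1985RegularSpaces, (1.24) p.79] -/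
def AxialClose (L : ℕ) (y : Site d) (κ : Fin d) (α₁ : ℝ) (V₀ V' : Site d → Fin d → 𝔸ˣ) : Prop :=
  (∀ r : Fin d → Fin L, axialFn (mulCfg V' V₀) y (y + boxVec L r) = axialFn V₀ y (y + boxVec L r)) ∧
  (∀ r : Fin d → Fin L, axialFn (mulCfg V' V₀) (y + (L : ℤ) • e κ) (y + (L : ℤ) • e κ + boxVec L r)
      = axialFn V₀ (y + (L : ℤ) • e κ) (y + (L : ℤ) • e κ + boxVec L r)) ∧
  ‖(bavg L (mulCfg V' V₀) y κ : 𝔸) - bavg L V₀ y κ‖ < α₁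

omit [NormOneClass 𝔸] [NormedAlgebra ℂ 𝔸] [CompleteSpace 𝔸] in
/-- The sites of `B(c₋) ∪ B(c₊)` (`B8Lemma1Lattice.blockSites` = the `Finset` of `B(z)`).
[cite: Balaban1985RegularSpaces, (1.23) p.79] -/
def pairSites (L : ℕ) (y : Site d) (κ : Fin d) : Finset (Site d) :=
  blockSites L y ∪ blockSites L (y + (L : ℤ) • e κ)

omit [NormOneClass 𝔸] [NormedAlgebra ℂ 𝔸] [CompleteSpace 𝔸] in
/-- `mem_pairSites` — bookkeeping. [folklore] -/
theorem mem_pairSites {L : ℕ} {y : Site d} {κ : Fin d} {x : Site d} :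
    x ∈ pairSites L y κ ↔ InPair L y κ x := by
  simp [pairSites, InPair, mem_blockSites]

omit [NormOneClass 𝔸] [NormedAlgebra ℂ 𝔸] [CompleteSpace 𝔸] in
/-- The bonds `b` with both ends in `B(c₋) ∪ B(c₊)` — those for which (1.25) is concluded from the data at `c`
(p. 80 l. 2–4). [cite: Balaban1985RegularSpaces, (1.25) p.79, p.80] -/
def regionBonds (L : ℕ) (y : Site d) (κ : Fin d) : Finset (Site d × Fin d) :=
  ((pairSites L y κ) ×ˢ (univ : Finset (Fin d))).filter (fun b => b.1 + e b.2 ∈ pairSites L y κ)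

omit [NormOneClass 𝔸] [NormedAlgebra ℂ 𝔸] [CompleteSpace 𝔸] in
/-- **`pertDev V′ = sup_b |V′_b − 1|`** over the bonds of `B(c₋) ∪ B(c₊)` (`0` for an empty region).
[cite: Balaban1985RegularSpaces, (1.25) p.79] -/
def pertDev (L : ℕ) (y : Site d) (κ : Fin d) (V' : Site d → Fin d → 𝔸ˣ) : ℝ :=
  if h : (regionBonds L y κ).Nonempty then (regionBonds L y κ).sup' h (fun b => ‖((V' b.1 b.2 : 𝔸ˣ) : 𝔸) - 1‖)
  else 0

omit [NormOneClass 𝔸] [NormedAlgebra ℂ 𝔸] [CompleteSpace 𝔸] in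
/-- `pertDev_lt`: a strict bondwise bound on the region bounds `pertDev` (for a positive bound). [folklore] -/
theorem pertDev_lt {L : ℕ} {y : Site d} {κ : Fin d} {V' : Site d → Fin d → 𝔸ˣ} {B : ℝ} (hB : 0 < B)
    (h : ∀ x ν, InPair L y κ x → InPair L y κ (x + e ν) → ‖((V' x ν : 𝔸ˣ) : 𝔸) - 1‖ < B) :
    pertDev L y κ V' < B := by
  unfold pertDev
  split_ifs with hne
  · rw [Finset.sup'_lt_iff]
    intro b hb
    simp only [regionBonds, Finset.mem_filter, Finset.mem_product, Finset.mem_univ, and_true,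
      mem_pairSites] at hb
    exact h b.1 b.2 hb.1 hb.2
  · exact hB

/-- **The non-abelian Lemma-1 carriers**: one `B8.LocalData` per coarse bond `c = ⟨y, y + Le_κ⟩` of a corner
lattice of `ℤ^d`, configurations / perturbations = `G`-valued bond fields, `G = U1 𝔸` (the elements `u` of a
complete normed `ℂ`-algebra with `‖u‖, ‖u⁻¹‖ ≤ 1`; e.g. `G ⊂ U(N) ⊂ M_N(ℂ)` with the operator norm,
`lemma1_unitary`), `small` = (1.7)`_{k=1}` for `V₀` and `V′V₀`, `axialClose` = (1.24), `pertDev` = `sup |V′ − 1|`,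
all on `B(c₋) ∪ B(c₊)`. [cite: Balaban1985RegularSpaces, Lemma 1 p.79, (1.23), p.80 l.2–4] -/
def blockPairNA (d L : ℕ) (𝔸 : Type) [NormedRing 𝔸] [NormOneClass 𝔸] [NormedAlgebra ℂ 𝔸] [CompleteSpace 𝔸]
    (c : Site d × Fin d) : B8.LocalData where
  Cfg := Site d → Fin d → 𝔸ˣ
  Pert := Site d → Fin d → 𝔸ˣ
  small := fun α₀ V₀ V' => Small L c.1 c.2 α₀ V₀ V'
  axialClose := fun α₁ V₀ V' => AxialClose L c.1 c.2 α₁ V₀ V'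
  pertDev := fun V' => pertDev L c.1 c.2 V'

/-- **`B8.Lemma1Printed` (= the DAG leaf `DagBinding.B8LeafR.l1`) HOLDS for the non-abelian carriers
`blockPairNA d L 𝔸`**, hypothesis-free, with the smallness constant `c = 1/(6(d+1))` for "α₀, α₁ small"
(`L = 0`: empty region; `d = 0`: no index). [cite: Balaban1985RegularSpaces, Lemma 1 (1.24)–(1.25) pp.79–80] -/
theorem lemma1Printed_blockPairNA (d L : ℕ) (𝔸 : Type) [NormedRing 𝔸] [NormOneClass 𝔸] [NormedAlgebra ℂ 𝔸]
    [CompleteSpace 𝔸] : B8.Lemma1Printed d (blockPairNA d L 𝔸) := by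
  refine ⟨1 / (6 * ((d : ℝ) + 1)), by positivity, ?_⟩
  rintro ⟨y, κ⟩ α₀ α₁ hα₀ hα₀' hα₁ hα₁' V₀ V' hS hA
  change pertDev L y κ V' < 4 * (d : ℝ) ^ 2 * α₀ + α₁
  have hbound : 0 < 4 * (d : ℝ) ^ 2 * α₀ + α₁ := by positivity
  rcases Nat.eq_zero_or_pos L with hL0 | hLpos
  · subst hL0
    refine pertDev_lt hbound ?_
    intro x ν hx _
    exfalso
    rcases hx with hx | hx
    · have := hx κ; omega
    · have := hx κ; omega
  · obtain ⟨hV₀, hV', hP0, hPU⟩ := hS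
    obtain ⟨hax, hax₁, havg⟩ := hA
    have H : Hyp L (mulCfg V' V₀) V₀ y κ (α₀ / (L : ℝ) ^ 2) α₁ :=
      { memU := fun x μ => (U1 𝔸).mul_mem (hV' x μ) (hV₀ x μ)
        memV₀ := hV₀
        plaqU := hPU.le
        plaqV₀ := hP0.le
        axial := hax
        axial₁ := hax₁
        avg := havg.le }
    have hα₁6 : α₁ ≤ 1 / 6 :=
      hα₁'.trans (one_div_le_one_div_of_le (by norm_num) (by nlinarith [Nat.cast_nonneg (α := ℝ) d]))
    refine pertDev_lt hbound fun x ν hx hxν => ?_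
    have hb := lemma1_printedBound hLpos H hα₀ hα₀' hα₁.le hα₁6 x ν hx hxν
    rwa [pert_mulCfg] at hb

end Leaf

/-! ### Dictionary entry: `G ⊂ U(N)`, or the unitary group of any C⋆-algebra, is `U1`-valued -/

section UnitaryCase

variable {𝔸 : Type*} [CStarAlgebra 𝔸] [Nontrivial 𝔸]

/-- **Lemma 1 for unitary-valued fields** (the printed setting "`G ⊂ U(N)`", [Balaban1985Averaging] p. 18; here
the unitary group `B7Prop2Explicit.unitaryUnits 𝔸` of any non-trivial C⋆-algebra, in particular of `M_N(ℂ)` with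
the operator norm): membership in `U1` is automatic (`B7Prop2Explicit.unitaryUnits_le_U1`), so `Hyp` only asks
(1.7)`_{k=1}` and (1.24), and (1.25) follows with the printed constant.
[cite: Balaban1985RegularSpaces, Lemma 1 p.79] -/
theorem lemma1_unitary {L : ℕ} (hL : 1 ≤ L) {V₀ V' : Site d → Fin d → 𝔸ˣ}
    (hV₀ : ∀ x μ, V₀ x μ ∈ B7Prop2Explicit.unitaryUnits 𝔸) (hV' : ∀ x μ, V' x μ ∈ B7Prop2Explicit.unitaryUnits 𝔸)
    {y : Site d} {κ : Fin d} {α₀ α₁ : ℝ}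
    (hP0 : PlaqSmall V₀ y (y + pairTop L κ) (α₀ / (L : ℝ) ^ 2))
    (hPU : PlaqSmall (mulCfg V' V₀) y (y + pairTop L κ) (α₀ / (L : ℝ) ^ 2))
    (hax : ∀ r : Fin d → Fin L, axialFn (mulCfg V' V₀) y (y + boxVec L r) = axialFn V₀ y (y + boxVec L r))
    (hax₁ : ∀ r : Fin d → Fin L, axialFn (mulCfg V' V₀) (y + (L : ℤ) • e κ) (y + (L : ℤ) • e κ + boxVec L r)
      = axialFn V₀ (y + (L : ℤ) • e κ) (y + (L : ℤ) • e κ + boxVec L r))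
    (havg : ‖(bavg L (mulCfg V' V₀) y κ : 𝔸) - bavg L V₀ y κ‖ ≤ α₁)
    (hα₀ : 0 < α₀) (hα₀' : α₀ ≤ 1 / (6 * ((d : ℝ) + 1))) (hα₁ : 0 ≤ α₁) (hα₁' : α₁ ≤ 1 / 6)
    (x : Site d) (ν : Fin d) (hx : InPair L y κ x) (hxν : InPair L y κ (x + e ν)) :
    ‖((V' x ν : 𝔸ˣ) : 𝔸) - 1‖ < 4 * (d : ℝ) ^ 2 * α₀ + α₁ := by
  have hV₀' : ∀ x μ, V₀ x μ ∈ U1 𝔸 := fun x μ => B7Prop2Explicit.unitaryUnits_le_U1 (hV₀ x μ)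
  have hV'' : ∀ x μ, V' x μ ∈ U1 𝔸 := fun x μ => B7Prop2Explicit.unitaryUnits_le_U1 (hV' x μ)
  have H : Hyp L (mulCfg V' V₀) V₀ y κ (α₀ / (L : ℝ) ^ 2) α₁ :=
    { memU := fun x μ => (U1 𝔸).mul_mem (hV'' x μ) (hV₀' x μ)
      memV₀ := hV₀'
      plaqU := hPU
      plaqV₀ := hP0
      axial := hax
      axial₁ := hax₁
      avg := havg }
  have hb := lemma1_printedBound hL H hα₀ hα₀' hα₁ hα₁' x ν hx hxν
  rwa [pert_mulCfg] at hb

end UnitaryCase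

end Literature.MathematicalPhysics.QuantumFieldTheory.Balaban1983to89.B8Lemma1NonAbelian

/-! ## Axiom audit (gate whitelist: `propext`, `Classical.choice`, `Quot.sound`) -/
#print axioms Literature.MathematicalPhysics.QuantumFieldTheory.Balaban1983to89.B8Lemma1NonAbelian.lemma1_explicit
#print axioms Literature.MathematicalPhysics.QuantumFieldTheory.Balaban1983to89.B8Lemma1NonAbelian.lemma1Printed_blockPairNA
#print axioms Literature.MathematicalPhysics.QuantumFieldTheory.Balaban1983to89.B8Lemma1NonAbelian.lemma1_unitary
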